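/-
Copyright: cell pub-balaban (hub tree, Literature side). Authors: seat b2b-balaban-b12-g21 (planner-b2b-balaban-b12-g21-0).
v1.1 (docstring-only DOCFIX, seat b2b-balaban-b12-g22): XREAD pv22-g21 (cell journal l.59420) items M-1 (`LQ` docstring:
the gloss "the linearization LQ̃ of Q̃" was not a printed sentence — replaced by p. 267's own words) = adv2-g72 D-1,
and M-2 (`IsBlockLocal` docstring: the contour-family sentence now quoted from p. 252); the bound on `‖h(c)‖` labelled
as the cell's (p. 267 prints none; adv2-g75); pointer to the successor module `B12PlaquetteLoop267` (plaquette ⇒ loop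
step).  Every declaration is byte-identical to v1 (p192457).
-/
import Mathlib
import Literature.MathematicalPhysics.QuantumFieldTheory.Balaban1983to89.B12HOperatorNeumann267
import Literature.MathematicalPhysics.QuantumFieldTheory.Balaban1983to89.B7Eq78Linearization
import Literature.Analysis.SpecialFunctions.LogFDeriv
import Literature.Analysis.Calculus.ExpDuhamel
import Literature.MathematicalPhysics.QuantumLattice.LieTrotter

/-!
# `Balaban1983to89.B12AverageCorridor267` — B12 [Balaban1987RG1] pp. 254, 266–267: the corridor coefficient of the
# GENUINE linearization `LQ̃` of (2.4) for the block average ((0.12)-shape; [B7] (15) verbatim), COMPUTED: main term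
# `L^{1−d}Ad_{g(c)}` minus an explicit loop-holonomy correction `S(c)` with `‖S(c)‖ ≤ 24ε` under a small field on
# the block loops — the free binder `S` and the Neumann hypothesis of `B12HOperatorNeumann267` DISCHARGED.

## CITATION HEADER

* [B12] = [Balaban1987RG1] T. Bałaban, *Renormalization group approach to lattice gauge field theories. I. Generation
  of effective actions in a small field approximation and a coupling constant renormalization in four dimensions*,
  Commun. Math. Phys. **109** (1987) 249–301; pp. 252, 253, 254, 265, 266, 267 [PDF 4, 5, 6, 17, 18, 19] (renders
  `b2b-balaban-ref1/pages/1987-cmp109-rg-I-small-field/1987-cmp109-rg-I-small-field-p0NN-x2.png`, NN = 04, 05, 06, 17,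
  18, 19, read as images by this seat).
* [B7] = [Balaban1985Averaging] T. Bałaban, *Averaging operations for lattice gauge theories*, Commun. Math. Phys.
  **98** (1985) 17–51; p. 19 [PDF 3] (render `…/1985-cmp98-averaging/1985-cmp98-averaging-p003-x2.png`, read as an
  image by this seat); (56), (61), Prop. 4 only through the tree modules `B7Eq61Linearization`, `B7Eq78Linearization`,
  `B12HOperator267`.
* [2] = [Balaban1984PropagatorsI] T. Bałaban, *Propagators and renormalization transformations for lattice gauge
  theories. I*, Commun. Math. Phys. **95** (1984) 17–40, (1.7) p. 18 — only through `B12HOperator267.gammaT`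
  (no new quotation here).

## WHAT IS PRINTED (verbatim, «…»)

* [B12] p. 252: *«In the previous papers we have used the definition introduced in [12]. This definition has one
  disadvantage, it is not symmetric with respect to lattice Euclidean transformations.»* ([12] = [B7].)
* [B7] (15) p. 19: *«Ū_c = exp[i Σ_{x∈B(c₋)} L⁻ᵈ (1/i) log U(Γ_{c,x}) U(c)⁻¹] U(c).»*, with, just before, *«Let us
  notice that Γ_{c₋,x} ∪ [x, x(c)] ∪ Γ_{x(c),c₊} is an oriented contour with c₋ as an initial point and c₊ as a final
  point. We denote it by Γ_{c,x}.»*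
* [B12] (0.12) p. 254: *«Ū(c) = exp[i Σ_{x∈B(c₋)} L⁻ᵈ (1/i) log 𝐔(c₋, x)𝐔([x, x′])𝐔(x′, c₊)𝐔(−c)] 𝐔(c).»* (with the
  averaged contour variables (0.11) *«𝐔(y, x) = M({𝐔(Γ)}_{Γ∈𝐆(y,x)})»*), and: *«This average has properties similar
  to the properties of the average introduced in (0.4), especially all results of the paper [12] are valid for it.
  […] Let us stress that both definitions are equally good for our purposes, in fact we may use many other
  definitions. It is possible to axiomatize them also, listing all essential properties, but it is not interesting
  enough to do it here.»*; p. 254 also: *«restricted to regular configurations U, i.e. configurations satisfying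
  bounds |U(∂p) − 1| < ε₀, p ∈ T, with ε₀ positive and sufficiently small»*.
* [B12] p. 265: *«We introduce new integration variables V′ = V(V⁽ᵏ⁾)⁻¹, or V = V′V⁽ᵏ⁾, and we assume that the
  characteristic function χ_k and the δ-functions in (2.1) restrict the variables B′ = (1/i) log V′ to a sufficiently
  small neighborhood of 0.»*; (2.4) p. 266: *«M(V′V⁽ᵏ⁾)M(V⁽ᵏ⁾)⁻¹ = exp iQ̃(B′).»*
* [B12] p. 267: *«At first we introduce an operator h. […] The function hB is equal to 0 everywhere, except the set
  {b₀(c) : c ∈ T⁽ᵏ⁺¹⁾}. […] Furthermore, the operator h satisfies the identity LQ̃h = I on T⁽ᵏ⁺¹⁾. Of course h is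
  uniquely defined by these conditions, in fact it is a very simple operator given by the equality
  (hB)(b₀(c)) = h(c)B(c), where h(c) is a linear operator on the Lie algebra 𝐠, equal to an inverse of a coefficient
  at the variable B′(b₀(c)) in (Q̃B′)(c), multiplied by L⁻¹.»* and, same page, the decomposition of `Q̃` into its
  linear part and the rest: *«LQ̃B′ + C̃(B′) = LQ̃B − D̃(B) + C̃(B − hD̃(B)) = LQ̃B.»*

## THE TYPING (= cell DIVERGENCE D-b12g21.1; honest scope)

`B12HOperator267` inverted the MAIN TERM `L^{1−d}Ad_{g(c)}` of the corridor coefficient; `B12HOperatorNeumann267`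
typed "main term − corrections `S(c)`, `(Lᵈ/L)‖S(c)‖ < 1`" (the lineage's phrase) as a FREE BINDER and derived the two
printed clauses («LQ̃h = I», uniqueness) and the cell's bound on `‖h(c)‖` from it.  THIS MODULE COMPUTES `S(c)` for the block average itself and BOUNDS it, so that no hypothesis on the average is
left — for [B7] (15) literally, for [B12] (0.12) up to the untyped contour average (0.11):

* (a) GEOMETRY as in the whole lineage (DIVERGENCE D-b12g20.1): corner cubes `B(y) = L y + {0,…,L−1}ᵈ` on `ℤᵈ`
  (print: cubes centred at `y` on a torus), corridor bond `b₀(c) = (L c₋ + (L−1)e_μ, μ)`, axis sites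
  `x_l(c) = L c₋ + l e_μ`.
* (b) THE AVERAGE in the SINGLE-FAMILY FORM `M_c(U) = exp[Σ_{x∈B(c₋)} L⁻ᵈ log W_x(U)]·U(c)`,
  `W_x(U) = 𝒯_U(x)·U([x,x′])·𝒯_U(x′)⁻¹·U(c)⁻¹` (`U(c)` = the straight transporter `Ustr` along the coarse bond,
  `x′ = x + L e_μ`), for an ABSTRACT site-transporter family `𝒯 : (bonds → 𝔸ˣ) → sites → 𝔸ˣ` subject to two typed
  axioms: `IsBlockLocal` (`𝒯_U(x)` depends only on the bonds inside the block of `x`) and `IsAxisStraightFamily` (on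
  the axis line through the block base it is the straight transporter).  For `𝒯_U = U(Γ_{y,·})` (the contours (1.7)
  of [2]) this is [B7] (15) VERBATIM (`W_x(U) = U(Γ_{c,x})U(c)⁻¹`, using `U(Γ_{x(c),c₊}) = U(Γ_{c₊,x(c)})⁻¹`) and
  BOTH axioms are PROVED (§ 9).  For `𝒯_U = 𝐔(y,·)` of (0.11) it is (0.12) (using (0.5) for `𝐔(x′,c₊) = 𝐔(c₊,x′)⁻¹`);
  (0.11) itself (the group average `M` of (0.5)–(0.10)) is NOT typed, so for (0.12) the two axioms remain
  hypotheses (informally: `𝐆(y,x) ⊂ B(y)`, and for `x` on an axis line `𝐆(y,x)` is the single straight contour, whose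
  average is itself by (0.10)).  The contour-PAIR average (0.4) is not of this form and is not covered («both
  definitions are equally good for our purposes»).
* (c) «LQ̃» — print's LINEAR PART of `Q̃` (p. 267 «LQ̃B′ + C̃(B′)») — is typed as the DIRECTIONAL DERIVATIVE AT `B′ = 0`:
  `LQ L 𝒯 V B′ c := d/ds|_{s=0} Q̃_V(sB′)(c)` (Mathlib `deriv`, junk `0` where not differentiable), with
  `Q̃_V(B′)(c) := (−i)·log(M_c(V′V)M_c(V)⁻¹)`, `V′(b) = exp(iB′(b))` bondwise ((2.4) read as the definition of `Q̃`).
  Fréchet differentiability of (2.4) in `B′` and additivity of `LQ̃` are NOT proved; the derivative is COMPUTED (kernel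
  `HasDerivAt`) only along the corridor directions `B′ = s·δ_{b₀(c)}X`, which is all the corridor coefficient
  `bcoef` of `B12HOperator267` reads; `IsQppLocal` holds for the `deriv`-defined map outright.
* (d) ALGEBRA: `𝔸` is a complex Banach algebra with `‖1‖ = 1` (matrices `M_N(ℂ)` with the operator norm), the gauge
  group is `𝔸ˣ`, `𝐠` is replaced by `𝔸` itself, `log` is the power series `MatrixLog.mlog` at `1`, `exp` is
  `NormedSpace.exp ℂ`, `(1/i)` is multiplication by `−i`; no unitarity, trace or Lie-subalgebra structure is used —
  the two printed clauses and the bound are statements about linear maps and norms.  The real-Banach-space framework of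
  `B12HOperatorNeumann267` is entered through `NormedAlgebra.complexToReal` and `ConjAct 𝔸ˣ` (`Tconj`, `Rconj`).
* (e) SMALL FIELD AT LOOP LEVEL: the hypothesis is `‖W_x(V) − 1‖ ≤ ε` for the `Lᵈ − L` off-axis loops of each block,
  `0 ≤ ε ≤ 1/8`, plus `‖V(b)‖ ≤ 1`, `‖V(b)⁻¹‖ ≤ 1` (unitary bond variables).  Print's regularity is plaquette-level
  («|U(∂p) − 1| < ε₀»); the passage plaquettes ⇒ block loops (a lattice Stokes count, `O(L²)` plaquettes per loop) is
  NOT typed here (v1.1 note: it is typed SINCE, in the successor module `B12PlaquetteLoop267` —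
  `norm_loopW_sub_one_le`, `h_paragraph_p267_regular` — through a proved dictionary to `B7Prop1Explicit` /
  `B8Lemma1NonAbelian`; nothing in this module changed).  The constant `24` and the threshold `1/8` are this
  module's (crude) choices, and so is the bound (iii) on `‖h(c)‖` below — p. 267 prints NO norm bound on `h`; the budget
  `(Lᵈ/L)·24ε < 1` is the Neumann hypothesis `hS` of `B12HOperatorNeumann267.h_paragraph_p267_mainTerm`.

## WHAT IS PROVED (kernel, no `sorry`; tags: [folklore] = calculus / bookkeeping, [cite] = transcription of a printed
formula under the typing above)

* § 1  contour algebra (`pathProd_congr`, `lineR_congr`, `map_pathProd`, `map_lineR`, `Ustr`,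
  `Ustr_eq_gcorner_mul : U(c) = g(c)·U(b₀(c))`), the two family axioms `IsBlockLocal`, `IsAxisStraightFamily`;
  § 1b block geometry (`axisSites`, `offAxis`, `card_offAxis : #offAxis = Lᵈ − L`, `sum_blockSites_eq`).
* § 2  `loopW` (= `B7Eq61Linearization.loopHol` with `Rc = Ustr`), `loopW_congr` (locality), **`loopW_axisSite`: the
  `L` axis loops are `≡ 1`**, `expU`, `avgM` (= `M_c(U)` as a unit), `pert` (`V′V`), `Qtilde` ((2.4)), `LQ` («LQ̃»).
* § 3  **`isQppLocal_LQ : IsQppLocal L (LQ L 𝒯 V)`** from `IsBlockLocal` ([B7] Prop. 4 shape; hypothesis `h𝒬` of the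
  Neumann module).
* § 4  along `B′ = s·δ_{b₀(c)}X`: the off-axis loops do not contain `b₀(c)` and become `W_x(V)·Ad_{g(c)}(e^{−isX})`
  (`loopW_pert_single_of_mem_offAxis`), `U(c)` becomes `g(c)e^{isX}V(b₀(c))`; **`curve_eq`**:
  `M_c(V′_sV)M_c(V)⁻¹ = exp E(s)·exp(is X̃)·exp(−Y)`, `X̃ = Ad_{g(c)}X`, `E(s) = Σ_{x∉axis} L⁻ᵈ log(W_x e^{−isX̃})`,
  `Y = E(0)` (`Eexp`, `Yexp`).
* § 5  **THE DERIVATIVE** (Fréchet derivatives `Dmlog W = (D log)_W`, `Dexp Y = (D exp)_Y` from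
  `Literature.Analysis.SpecialFunctions.LogFDeriv` / `ExpFDeriv` BY NAME; `hasFDerivAt_mlog`, `hasDerivAt_Eexp`):
  **`hasDerivAt_Qtilde_single`** and **`bcoef_LQ : bcoef L (LQ L 𝒯 V) c X = bcoefVal L 𝒯 V c X`**
  `= Ad_{e^Y}X̃ − (D exp)_Y(Σ_{x∉axis} L⁻ᵈ (D log)_{W_x}(W_x X̃))·e^{−Y}` (needs `‖W_x − 1‖ < 1` off-axis).
* § 6  as continuous linear maps: `AdU`, `PsiW W = (D log)_W ∘ (W·)`, `PhiY Y = (·)e^{−Y} ∘ (D exp)_Y`, `bcoefL`,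
  `coefL = (L⁻ᵈ·L)•Ad_{g(c)}` (`coefL_apply_eq_coef`: it IS `B12HOperator267.coef` in the `ConjAct` model),
  **`Scorr L 𝒯 V c : 𝔸 →L[ℝ] 𝔸 := coefL − bcoefL`** and **`bcoef_LQ_eq_coef_sub : bcoef = coef − S(c)`** (hypothesis
  `hK` of the Neumann module); § 6b **`Scorr_eq_zero_of_flat`**: `S(c) = 0` when all off-axis loops are `1` (the main
  term is exact at flat block loops, e.g. pure-gauge backgrounds).
* § 7  NORMS: `δ_A = ‖Ad_{e^Y} − 1‖ ≤ e^{2‖Y‖} − 1`, `δ_Φ = ‖Φ_Y − 1‖ ≤ e^{2‖Y‖} − 1` (`norm_Dexp_sub_one_le :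
  ‖(D exp)_Y − 1‖ ≤ e^{‖Y‖} − 1`), `δ_Ψ = ‖Ψ_W − 1‖ ≤ 4‖W − 1‖` (for `‖W−1‖ ≤ 1/2`), `‖Y‖ ≤ 2ε`,
  **`coefL_sub_bcoefL`** (the correction as `[(1 − Ad_{e^Y}) + (Φ_Y − 1)∘Σ L⁻ᵈΨ_x + Σ L⁻ᵈ(Ψ_x − 1)] ∘ Ad_{g(c)}`, using
  `L^{1−d} = 1 − (Lᵈ−L)L⁻ᵈ`), **`norm_Scorr_le_struct`**, **`norm_Scorr_le : ‖S(c)‖ ≤ 24ε`** (`0 ≤ ε ≤ 1/8`,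
  `‖g(c)‖, ‖g(c)⁻¹‖ ≤ 1`; `8ε + 8ε(1+4ε) + 4ε ≤ 24ε`).
* § 8  **`neumann_budget`**: `(Lᵈ/L)‖S(c)‖ < 1` from `(Lᵈ/L)·24ε < 1` (hypothesis `hS` of the Neumann module
  DISCHARGED); `hGen` = the fibre maps `(K(c) − S(c))⁻¹`; **`h_paragraph_p267_genuine`**: for `𝒬 = LQ̃_V` the two
  printed clauses — «LQ̃h = I» for `h = hOp b₀ hGen`, «h is uniquely defined» among corridor-supported right inverses —
  and the cell's bound `‖h(c)X‖ ≤ (Lᵈ/L)/(1 − (Lᵈ/L)·24ε)·‖X‖` (not printed) — by `B12HOperatorNeumann267.h_paragraph_p267_mainTerm` with every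
  hypothesis supplied (`isQppLocal_LQ`, `bcoef_LQ_eq_coef_sub`, `neumann_budget`, `axisStraight_conj`,
  `norm_Rconj_le`).
* § 9  THE PRINTED INSTANCE [B7] (15): **`isBlockLocal_gammaT`** (the contours (1.7) stay in the block),
  **`isAxisStraightFamily_gammaT`**, **`h_paragraph_p267_gammaT`** (§ 8 with no hypothesis on the average), and the
  non-vacuity witness `flat_hypotheses` (`V ≡ 1`, `ε = 0`).

NOT DONE HERE (GAPS, cell records C-b12g21-1): (0.11)/(0.4); centred cubes and the torus; plaquette ⇒ loop small
field; differentiability of (2.4) beyond the corridor directions and the identification of the `deriv`-defined «LQ̃»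
with a Fréchet derivative; any use of `𝐠 ⊂ 𝔸` (reality, tracelessness) — none is needed for the three clauses (two printed + the bound).
-/

noncomputable section

open NormedSpace Finset

namespace Literature.MathematicalPhysics.QuantumFieldTheory.Balaban1983to89.B12AverageCorridor267

open Literature.Analysis.Complex (logOnePlus mem_eball_expSeries_radius)
open Literature.Analysis.Calculus (norm_exp_sub_one_le)
open Literature.Analysis.SpecialFunctions
open Literature.MathematicalPhysics.QuantumLattice (ZdEdge blockMap blockBase blockSites mem_blockSites_iff
  card_blockSites blockMap_blockBase_add_of_lt blockMap_blockBase)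
open B7BlockGeometry (qppBonds mem_qppBonds twoBlocks line_mem_twoBlocks blockSites_add_single)
open B7Eq61Linearization (pathProd pathProd_zero pathProd_succ lineR loopHol conjAct_smul_eq)
open B7Eq78Linearization (conjR conjR_apply hasDerivAt_mlog_comp hasDerivAt_exp_smul_zero)
open B13CorridorSeparation (b0Z b0Z_mem_qppBonds blockMap_b0Z_fst)
open B12HOperator267 (IsQppLocal bcoef CorridorSupported axisSite axisSite_mem_blockSites bond_eq_b0Z_iff AxisStraight
  gcorner coef coef_eq_of_axisStraight lineR_add lineR_zero line_bond_mem_qppBonds gammaPt gammaT axisStraight_gammaT)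
open B13PkLocalTerms (hOp)
open B12HOperatorNeumann267 (relPert hNeu hH_of_budget KMain norm_KMain_symm_le h_paragraph_p267_mainTerm)
open MatrixLog (mlog mlog_def mlog_one)

variable {d : ℕ}

/-! ## § 1  Contour algebra complements [folklore] -/

section Contour

variable {G H : Type*} [Monoid G] [Monoid H]

/-- [folklore] an ordered product depends only on the factors it uses. -/
theorem pathProd_congr {g g' : ℕ → G} {n : ℕ} (h : ∀ t, t < n → g t = g' t) : pathProd g n = pathProd g' n := by
  induction n with
  | zero => rw [pathProd_zero, pathProd_zero]
  | succ n ih =>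
    rw [pathProd_succ, pathProd_succ, ih fun t ht => h t (Nat.lt_succ_of_lt ht), h n (Nat.lt_succ_self n)]

/-- [folklore] the straight transporter `U([x, x + n e_μ])` depends only on the bonds of the segment. -/
theorem lineR_congr {U U' : ZdEdge d → G} {x : Fin d → ℤ} {μ : Fin d} {n : ℕ}
    (h : ∀ t : ℕ, t < n → U (x + Pi.single μ (t : ℤ), μ) = U' (x + Pi.single μ (t : ℤ), μ)) :
    lineR U x μ n = lineR U' x μ n := by
  unfold lineR
  exact pathProd_congr h

/-- [folklore] monoid homomorphisms pass through ordered products (B7 (9)). -/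
theorem map_pathProd {F : Type*} [FunLike F G H] [MonoidHomClass F G H] (φ : F) (g : ℕ → G) (n : ℕ) :
    φ (pathProd g n) = pathProd (fun t => φ (g t)) n := by
  induction n with
  | zero => rw [pathProd_zero, pathProd_zero, map_one]
  | succ n ih => rw [pathProd_succ, pathProd_succ, map_mul, ih]

/-- [folklore] … and through straight transporters. -/
theorem map_lineR {F : Type*} [FunLike F G H] [MonoidHomClass F G H] (φ : F) (U : ZdEdge d → G)
    (x : Fin d → ℤ) (μ : Fin d) (n : ℕ) : φ (lineR U x μ n) = lineR (fun b => φ (U b)) x μ n :=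
  map_pathProd φ _ n

/-- [cite: Balaban1987RG1, (0.12) p.254] the factor `U(c)` of (0.12): the straight holonomy of the coarse bond
`c = ⟨y, y + e_μ⟩` read on the fine lattice, `U([L y, L y + L e_μ])` (corner cubes; [2] (1.8) `x(c) = x + Le_μ`). -/
def Ustr (L : ℕ) (U : ZdEdge d → G) (c : ZdEdge d) : G := lineR U (blockBase L c.1) c.2 L

/-- [folklore] a one-bond segment. -/
theorem lineR_one (U : ZdEdge d → G) (x : Fin d → ℤ) (μ : Fin d) : lineR U x μ 1 = U (x, μ) := by
  unfold lineR
  rw [show (1 : ℕ) = 0 + 1 from rfl, pathProd_succ, pathProd_zero, one_mul]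
  simp

/-- [folklore] `U(c) = g(c) · U(b₀(c))`: the first `L − 1` bonds of `[L c₋, L c₊]` give `g(c)` of `B12HOperator267`,
the last one is the corridor bond `b₀(c)` of `B13CorridorSeparation`. -/
theorem Ustr_eq_gcorner_mul {L : ℕ} (hL : 0 < L) (U : ZdEdge d → G) (c : ZdEdge d) :
    Ustr L U c = gcorner L U c * U (b0Z L c) := by
  unfold Ustr gcorner
  obtain ⟨n, rfl⟩ : ∃ n, L = n + 1 := ⟨L - 1, (Nat.sub_add_cancel hL).symm⟩
  rw [lineR_add, Nat.add_sub_cancel, lineR_one]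
  simp only [b0Z, Nat.cast_succ, add_sub_cancel_right]

/-- [folklore] **block-locality of a site-transporter family**: `𝒯_U(x)` depends only on the bond variables `U(b)`
of bonds `b` INSIDE the block of `x` (both endpoints in it) — the property of the contours `Γ_{y,x} ⊂ B(y)` of
[2] (1.7) and of the averaged contour variables (0.11), [B12] p. 252: «For a point x ∈ B(y) we take a family
𝐆(y, x) of shortest contours with the initial point at y, and the final point at x» (shortest lattice contours
between two points of the cube stay inside the cube; v1.1: quotation corrected, XREAD pv22-g21 M-2). -/
def IsBlockLocal (L : ℕ) (𝒯 : (ZdEdge d → G) → (Fin d → ℤ) → G) : Prop :=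
  ∀ (U U' : ZdEdge d → G) (y x : Fin d → ℤ), x ∈ blockSites L y →
    (∀ b : ZdEdge d, b.1 ∈ blockSites L y → b.1 + Pi.single b.2 1 ∈ blockSites L y → U b = U' b) →
    𝒯 U x = 𝒯 U' x

/-- [folklore] **axis straightness of the family**: for every configuration, the transporter to a site on an axis
line of its block is the straight one (`B12HOperator267.AxisStraight`; for (0.11): `𝐆(y,x)` is the single straight
segment when `x − y` has one non-zero coordinate, and the average of one contour is that contour by (0.10)). -/
def IsAxisStraightFamily (L : ℕ) (𝒯 : (ZdEdge d → G) → (Fin d → ℤ) → G) : Prop :=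
  ∀ U : ZdEdge d → G, AxisStraight L (𝒯 U) U

end Contour

/-! ## § 1b  Block geometry complements [folklore] -/

section Geometry

/-- [folklore] a bond inside `B(c₋)` is a bond of `B(c₋) ∪ B(c₊)` ([B7] (140)). -/
theorem inner_mem_qppBonds_fst {L : ℕ} (c : ZdEdge d) {b : ZdEdge d} (h1 : b.1 ∈ blockSites L c.1)
    (h2 : b.1 + Pi.single b.2 1 ∈ blockSites L c.1) : b ∈ qppBonds L c := by
  rw [mem_qppBonds]
  simp only [twoBlocks, mem_union]
  exact ⟨Or.inl h1, Or.inl h2⟩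

/-- [folklore] a bond inside `B(c₊)` is a bond of `B(c₋) ∪ B(c₊)`. -/
theorem inner_mem_qppBonds_snd {L : ℕ} (c : ZdEdge d) {b : ZdEdge d}
    (h1 : b.1 ∈ blockSites L (c.1 + Pi.single c.2 1)) (h2 : b.1 + Pi.single b.2 1 ∈ blockSites L (c.1 + Pi.single c.2 1)) :
    b ∈ qppBonds L c := by
  rw [mem_qppBonds]
  simp only [twoBlocks, mem_union]
  exact ⟨Or.inr h1, Or.inr h2⟩

/-- [cite: Balaban1984PropagatorsI, (1.8) p.18] `x(c) = x + L e_μ ∈ B(c₊)` for `x ∈ B(c₋)`. -/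
theorem add_mem_blockSites_succ {L : ℕ} (hL : 0 < L) {y x : Fin d → ℤ} (μ : Fin d) (hx : x ∈ blockSites L y) :
    x + Pi.single μ (L : ℤ) ∈ blockSites L (y + Pi.single μ 1) := by
  rw [blockSites_add_single L hL, mem_image]
  exact ⟨x, hx, by rw [mul_one]⟩

/-- [folklore] `L(y + e_μ) = L y + L e_μ`. -/
theorem blockBase_add_single (L : ℕ) (y : Fin d → ℤ) (μ : Fin d) :
    blockBase L (y + Pi.single μ 1) = blockBase L y + Pi.single μ (L : ℤ) := by
  funext i
  by_cases hi : i = μ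
  · subst hi; simp [blockBase, mul_add]
  · simp [blockBase, Pi.single_eq_of_ne hi]

/-- [folklore] the corridor bond `b₀(c)` is NOT inside `B(c₋)`: its endpoint `b₀(c)₊ = L c₊` lies in `B(c₊)`. -/
theorem b0Z_snd_not_mem {L : ℕ} (hL : 0 < L) (c : ZdEdge d) :
    (b0Z L c).1 + Pi.single c.2 1 ∉ blockSites L c.1 := by
  haveI : NeZero L := ⟨hL.ne'⟩
  have h1 : (b0Z L c).1 + Pi.single c.2 1 = blockBase L (c.1 + Pi.single c.2 1) := by
    simp only [b0Z, blockBase_add_single, add_assoc, ← Pi.single_add, sub_add_cancel]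
  rw [h1, mem_blockSites_iff, blockMap_blockBase]
  intro h
  have := congr_fun h c.2
  simp at this

/-- [folklore] … and NOT inside `B(c₊)`: its endpoint `b₀(c)₋` lies in `B(c₋)`. -/
theorem b0Z_fst_not_mem {L : ℕ} (hL : 0 < L) (c : ZdEdge d) :
    (b0Z L c).1 ∉ blockSites L (c.1 + Pi.single c.2 1) := by
  haveI : NeZero L := ⟨hL.ne'⟩
  rw [mem_blockSites_iff, blockMap_b0Z_fst hL]
  intro h
  have := congr_fun h c.2
  simp at this

/-- [folklore] the `L` axis sites `x_l(c)`, `l < L`, as a finset. -/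
def axisSites (L : ℕ) (c : ZdEdge d) : Finset (Fin d → ℤ) := (range L).image (axisSite L c)

/-- [folklore] the `Lᵈ − L` sites of `B(c₋)` off the axis line of `c` through `b₀(c)`. -/
def offAxis (L : ℕ) (c : ZdEdge d) : Finset (Fin d → ℤ) := (blockSites L c.1).filter fun x => x ∉ axisSites L c

/-- [folklore] `l ↦ x_l(c)` is one-to-one. -/
theorem axisSite_injective (L : ℕ) (c : ZdEdge d) : Function.Injective (axisSite L c) := by
  intro l l' h
  have h1 := congr_fun h c.2
  simp only [axisSite, Pi.add_apply, Pi.single_eq_same] at h1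
  omega

/-- [folklore] `#axisSites = L`. -/
theorem card_axisSites (L : ℕ) (c : ZdEdge d) : (axisSites L c).card = L := by
  rw [axisSites, card_image_of_injective _ (axisSite_injective L c), card_range]

/-- [folklore] the axis sites lie in `B(c₋)`. -/
theorem axisSites_subset {L : ℕ} (hL : 0 < L) (c : ZdEdge d) : axisSites L c ⊆ blockSites L c.1 := by
  intro x hx
  obtain ⟨l, hl, rfl⟩ := mem_image.1 hx
  exact axisSite_mem_blockSites hL c (mem_range.1 hl)

/-- [folklore] `#offAxis = Lᵈ − L`. -/
theorem card_offAxis {L : ℕ} (hL : 0 < L) (c : ZdEdge d) : (offAxis L c).card = L ^ d - L := by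
  have h : offAxis L c = blockSites L c.1 \ axisSites L c := by
    ext x; simp [offAxis, mem_sdiff]
  rw [h, card_sdiff_of_subset (axisSites_subset hL c), card_blockSites, card_axisSites]

/-- [folklore] a site off the axis is none of the `x_l(c)`. -/
theorem ne_axisSite_of_mem_offAxis {L : ℕ} {c : ZdEdge d} {x : Fin d → ℤ} (hx : x ∈ offAxis L c) {l : ℕ}
    (hl : l < L) : x ≠ axisSite L c l := by
  rintro rfl
  exact (mem_filter.1 hx).2 (mem_image.2 ⟨l, mem_range.2 hl, rfl⟩)

/-- [folklore] a site off the axis lies in `B(c₋)`. -/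
theorem mem_blockSites_of_mem_offAxis {L : ℕ} {c : ZdEdge d} {x : Fin d → ℤ} (hx : x ∈ offAxis L c) :
    x ∈ blockSites L c.1 := (mem_filter.1 hx).1

/-- [folklore] splitting a sum over `B(c₋)` into the axis sites and the rest. -/
theorem sum_blockSites_eq {β : Type*} [AddCommMonoid β] {L : ℕ} (hL : 0 < L) (c : ZdEdge d) (F : (Fin d → ℤ) → β) :
    ∑ x ∈ blockSites L c.1, F x = ∑ l ∈ range L, F (axisSite L c l) + ∑ x ∈ offAxis L c, F x := by
  rw [← sum_filter_add_sum_filter_not (blockSites L c.1) (fun x => x ∈ axisSites L c), offAxis]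
  congr 1
  have h : (blockSites L c.1).filter (fun x => x ∈ axisSites L c) = axisSites L c := by
    ext x
    simp only [mem_filter, and_iff_right_iff_imp]
    exact fun hx => axisSites_subset hL c hx
  rw [h, axisSites, sum_image fun l _ l' _ h => axisSite_injective L c h]

end Geometry

/-! ## § 2  The block average in the single-family form ([B7] (15) / [B12] (0.12)) with a transporter family `𝒯`;
the perturbation `V′V`; `Q̃` of (2.4); «LQ̃» -/

section Loops

variable {G : Type*} [Group G]

/-- [cite: Balaban1987RG1, (0.12) p.254] the loop under the logarithm of (0.12) for the site `x ∈ B(c₋)`: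
`W_x(U) = 𝒯_U(x)·U([x,x′])·𝒯_U(x′)⁻¹·U(c)⁻¹` (`= 𝐔(c₋,x)𝐔([x,x′])𝐔(x′,c₊)𝐔(−c)` with `𝐔(y,·) = 𝒯`, `𝐔(x′,c₊) = 𝐔(c₊,x′)⁻¹` by (0.5); for
`𝒯_U = U(Γ_{y,·})` it is [B7] (15)'s `U(Γ_{c,x})U(c)⁻¹`; literally `B7Eq61Linearization.loopHol` with the coarse
holonomy `Rc = Ustr`). -/
def loopW (L : ℕ) (𝒯 : (ZdEdge d → G) → (Fin d → ℤ) → G) (U : ZdEdge d → G) (c : ZdEdge d) (x : Fin d → ℤ) : G :=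
  loopHol L (𝒯 U) U (Ustr L U) c x

/-- [folklore] unfolding. -/
theorem loopW_def (L : ℕ) (𝒯 : (ZdEdge d → G) → (Fin d → ℤ) → G) (U : ZdEdge d → G) (c : ZdEdge d)
    (x : Fin d → ℤ) :
    loopW L 𝒯 U c x = 𝒯 U x * lineR U x c.2 L * (𝒯 U (x + Pi.single c.2 (L : ℤ)))⁻¹ * (Ustr L U c)⁻¹ := rfl

variable {L : ℕ} {𝒯 : (ZdEdge d → G) → (Fin d → ℤ) → G}

/-- [cite: Balaban1985Averaging, Prop.4 p.38] (locality, loop level) `W_x(U)`, `x ∈ B(c₋)`, depends only on the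
bond variables of `B(c₋) ∪ B(c₊)`. -/
theorem loopW_congr (hL : 0 < L) (h𝒯 : IsBlockLocal L 𝒯) {U U' : ZdEdge d → G} {c : ZdEdge d}
    (hUU' : ∀ b ∈ qppBonds L c, U b = U' b) {x : Fin d → ℤ} (hx : x ∈ blockSites L c.1) :
    loopW L 𝒯 U c x = loopW L 𝒯 U' c x := by
  haveI : NeZero L := ⟨hL.ne'⟩
  rw [loopW_def, loopW_def]
  have h1 : 𝒯 U x = 𝒯 U' x :=
    h𝒯 U U' c.1 x hx fun b hb1 hb2 => hUU' b (inner_mem_qppBonds_fst c hb1 hb2)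
  have h2 : 𝒯 U (x + Pi.single c.2 (L : ℤ)) = 𝒯 U' (x + Pi.single c.2 (L : ℤ)) :=
    h𝒯 U U' (c.1 + Pi.single c.2 1) _ (add_mem_blockSites_succ hL c.2 hx)
      fun b hb1 hb2 => hUU' b (inner_mem_qppBonds_snd c hb1 hb2)
  have h3 : lineR U x c.2 L = lineR U' x c.2 L :=
    lineR_congr fun t ht => hUU' _ (line_bond_mem_qppBonds hL c hx ht)
  have h4 : Ustr L U c = Ustr L U' c := by
    unfold Ustr
    refine lineR_congr fun t ht => hUU' _ (line_bond_mem_qppBonds hL c ?_ ht)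
    rw [mem_blockSites_iff, blockMap_blockBase]
  rw [h1, h2, h3, h4]

/-- [folklore] **the axis loops are trivial**: for `x = x_l(c)` on the axis line through `b₀(c)` the contour
`Γ_{c₋,x} ∪ [x, x′] ∪ (−Γ_{c₊,x′}) ∪ (−c)` runs back and forth along one line, so `W_{x_l(c)}(U) = 1` for EVERY
configuration (concatenation `B12HOperator267.lineR_add`). -/
theorem loopW_axisSite (h𝒯 : IsAxisStraightFamily L 𝒯) (U : ZdEdge d → G) (c : ZdEdge d) {l : ℕ} (hl : l < L) :
    loopW L 𝒯 U c (axisSite L c l) = 1 := by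
  have hcast : ((L - 1 - l : ℕ) : ℤ) = (L : ℤ) - 1 - l := by omega
  have hx : axisSite L c l = blockBase L c.1 + Pi.single c.2 ((L - 1 - l : ℕ) : ℤ) := by
    rw [hcast]; rfl
  have hx' : axisSite L c l + Pi.single c.2 (L : ℤ)
      = blockBase L (c.1 + Pi.single c.2 1) + Pi.single c.2 ((L - 1 - l : ℕ) : ℤ) := by
    rw [hx, blockBase_add_single, add_assoc, add_assoc, ← Pi.single_add, ← Pi.single_add, add_comm (L : ℤ)]
  rw [loopW_def, hx', h𝒯 U (c.1 + Pi.single c.2 1) c.2 _ (by omega), hx, h𝒯 U c.1 c.2 _ (by omega)]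
  unfold Ustr
  have key : lineR U (blockBase L c.1) c.2 (L - 1 - l) *
      lineR U (blockBase L c.1 + Pi.single c.2 ((L - 1 - l : ℕ) : ℤ)) c.2 L
      = lineR U (blockBase L c.1) c.2 L * lineR U (blockBase L (c.1 + Pi.single c.2 1)) c.2 (L - 1 - l) := by
    rw [← lineR_add, show L - 1 - l + L = L + (L - 1 - l) by omega, lineR_add, blockBase_add_single]
  calc lineR U (blockBase L c.1) c.2 (L - 1 - l) * lineR U (blockBase L c.1 + Pi.single c.2 ↑(L - 1 - l)) c.2 L *
        (lineR U (blockBase L (c.1 + Pi.single c.2 1)) c.2 (L - 1 - l))⁻¹ * (lineR U (blockBase L c.1) c.2 L)⁻¹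
      = lineR U (blockBase L c.1) c.2 L * lineR U (blockBase L (c.1 + Pi.single c.2 1)) c.2 (L - 1 - l) *
        (lineR U (blockBase L (c.1 + Pi.single c.2 1)) c.2 (L - 1 - l))⁻¹ * (lineR U (blockBase L c.1) c.2 L)⁻¹ := by
        rw [key]
    _ = 1 := by group

end Loops

section Average

variable {𝔸 : Type*} [NormedRing 𝔸] [NormedAlgebra ℂ 𝔸] [CompleteSpace 𝔸]

/-- [folklore] `exp a` as a unit of the Banach algebra, inverse `exp(−a)`. -/
def expU (a : 𝔸) : 𝔸ˣ where
  val := exp a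
  inv := exp (-a)
  val_inv := by
    letI : NormedAlgebra ℚ 𝔸 := NormedAlgebra.restrictScalars ℚ ℂ 𝔸
    rw [← exp_add_of_commute (Commute.refl a).neg_right, add_neg_cancel, exp_zero]
  inv_val := by
    letI : NormedAlgebra ℚ 𝔸 := NormedAlgebra.restrictScalars ℚ ℂ 𝔸
    rw [← exp_add_of_commute (Commute.refl a).neg_left, neg_add_cancel, exp_zero]

/-- [folklore] unfolding. -/
@[simp] theorem val_expU (a : 𝔸) : ((expU a : 𝔸ˣ) : 𝔸) = exp a := rfl

/-- [folklore] unfolding. -/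
@[simp] theorem val_inv_expU (a : 𝔸) : (((expU a)⁻¹ : 𝔸ˣ) : 𝔸) = exp (-a) := rfl

/-- [folklore] `exp 0 = 1` as units. -/
@[simp] theorem expU_zero : expU (0 : 𝔸) = 1 := Units.ext (by simp)

/-- [folklore] `exp` of a conjugate is the conjugate of `exp` (`NormedSpace.exp_units_conj`, over `ℂ`). -/
theorem exp_conj_units (P : 𝔸ˣ) (a : 𝔸) : exp ((P : 𝔸) * a * ((P⁻¹ : 𝔸ˣ) : 𝔸)) = (P : 𝔸) * exp a * ((P⁻¹ : 𝔸ˣ) : 𝔸) := by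
  letI : NormedAlgebra ℚ 𝔸 := NormedAlgebra.restrictScalars ℚ ℂ 𝔸
  exact exp_units_conj P a

/-- [cite: Balaban1987RG1, (0.12) p.254] **the average (0.12)** (single transporter family, corner cubes) as a unit:
`M_c(U) = exp[Σ_{x∈B(c₋)} L⁻ᵈ log W_x(U)] · U(c)`. -/
def avgM (L : ℕ) (𝒯 : (ZdEdge d → 𝔸ˣ) → (Fin d → ℤ) → 𝔸ˣ) (U : ZdEdge d → 𝔸ˣ) (c : ZdEdge d) : 𝔸ˣ :=
  expU (∑ x ∈ blockSites L c.1, ((L : ℂ) ^ d)⁻¹ • mlog ((loopW L 𝒯 U c x : 𝔸ˣ) : 𝔸)) * Ustr L U c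

/-- [cite: Balaban1987RG1, p.265] the perturbed configuration `V′V⁽ᵏ⁾` with `V′ = exp(iB′)` bondwise
(«B′ = (1/i) log V′»). -/
def pert (B' : ZdEdge d → 𝔸) (V : ZdEdge d → 𝔸ˣ) : ZdEdge d → 𝔸ˣ := fun b => expU (Complex.I • B' b) * V b

/-- [folklore] unfolding. -/
theorem pert_apply (B' : ZdEdge d → 𝔸) (V : ZdEdge d → 𝔸ˣ) (b : ZdEdge d) :
    pert B' V b = expU (Complex.I • B' b) * V b := rfl

/-- [folklore] bonds where `B′ = 0` are not perturbed. -/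
theorem pert_apply_of_eq_zero {B' : ZdEdge d → 𝔸} (V : ZdEdge d → 𝔸ˣ) {b : ZdEdge d} (hb : B' b = 0) :
    pert B' V b = V b := by
  rw [pert_apply, hb, smul_zero, expU_zero, one_mul]

/-- [folklore] `V′V = V` at `B′ = 0`. -/
@[simp] theorem pert_zero (V : ZdEdge d → 𝔸ˣ) : pert (0 : ZdEdge d → 𝔸) V = V :=
  funext fun _ => pert_apply_of_eq_zero V rfl

/-- [cite: Balaban1987RG1, (2.4) p.266] **(2.4) read as the definition of `Q̃`**: `exp iQ̃_V(B′)(c) = M_c(V′V)M_c(V)⁻¹`,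
i.e. `Q̃_V(B′)(c) := (1/i) log (M_c(V′V) M_c(V)⁻¹)` (`1/i = −i`; `log = MatrixLog.mlog`, the series (21) of [B7]). -/
def Qtilde (L : ℕ) (𝒯 : (ZdEdge d → 𝔸ˣ) → (Fin d → ℤ) → 𝔸ˣ) (V : ZdEdge d → 𝔸ˣ) (B' : ZdEdge d → 𝔸)
    (c : ZdEdge d) : 𝔸 :=
  (-Complex.I) • mlog (((avgM L 𝒯 (pert B' V) c * (avgM L 𝒯 V c)⁻¹ : 𝔸ˣ) : 𝔸))

/-- [cite: Balaban1987RG1, p.267] **the linear part `LQ̃`** of `Q̃` at `B′ = 0` — p. 267 prints «we make a change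
of variables linearizing the function Q̃(B′)» and «LQ̃B′ + C̃(B′) = LQ̃B − D̃(B) + C̃(B − hD̃(B)) = LQ̃B» (`LQ̃` = the
linear part of `Q̃`, `C̃` the remainder); the gloss "the linearization LQ̃ of Q̃" is this lineage's PARAPHRASE, not a
printed sentence (v1.1, XREAD pv22-g21 M-1 = adv2-g72 D-1); a reader may equivalently parse «LQ̃» as `L·Q̃` with `Q̃`
the normalised linear averaging of [B7] (14) — the SAME operator (cf. the `B12HOperator267` header, `Q̃ = L⁻¹·(LQ̃)`,
`coefQt = L⁻¹K(c)`) —, typed as the DIRECTIONAL derivative `LQ̃_V(B′)(c) := d/ds|_{s=0} Q̃_V(sB′)(c)` (Mathlib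
`deriv`, over `ℂ`; as in `B7Eq78Linearization`, whose header reads the linear part as the first derivative at
`u = 1`). -/
def LQ (L : ℕ) (𝒯 : (ZdEdge d → 𝔸ˣ) → (Fin d → ℤ) → 𝔸ˣ) (V : ZdEdge d → 𝔸ˣ) (B' : ZdEdge d → 𝔸)
    (c : ZdEdge d) : 𝔸 :=
  deriv (fun s : ℂ => Qtilde L 𝒯 V (s • B') c) 0

/-! ## § 3  Locality of `LQ̃` ([B7] Prop. 4 shape): the hypothesis `h𝒬` of `B12HOperatorNeumann267`, PROVED -/

variable {L : ℕ} {𝒯 : (ZdEdge d → 𝔸ˣ) → (Fin d → ℤ) → 𝔸ˣ}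

/-- [cite: Balaban1985Averaging, Prop.4 p.38] `M_c(U)` depends on `U(b)`, `b ⊂ B(c₋) ∪ B(c₊)`, only. -/
theorem avgM_congr (hL : 0 < L) (h𝒯 : IsBlockLocal L 𝒯) {U U' : ZdEdge d → 𝔸ˣ} {c : ZdEdge d}
    (hUU' : ∀ b ∈ qppBonds L c, U b = U' b) : avgM L 𝒯 U c = avgM L 𝒯 U' c := by
  haveI : NeZero L := ⟨hL.ne'⟩
  unfold avgM
  have h4 : Ustr L U c = Ustr L U' c := by
    unfold Ustr
    refine lineR_congr fun t ht => hUU' _ (line_bond_mem_qppBonds hL c ?_ ht)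
    rw [mem_blockSites_iff, blockMap_blockBase]
  rw [h4, sum_congr rfl fun x hx => by rw [loopW_congr hL h𝒯 hUU' hx]]

/-- [cite: Balaban1985Averaging, Prop.4 p.38] `Q̃_V(B′)(c)` depends on `B′(b)`, `b ⊂ B(c₋) ∪ B(c₊)`, only. -/
theorem Qtilde_congr (hL : 0 < L) (h𝒯 : IsBlockLocal L 𝒯) (V : ZdEdge d → 𝔸ˣ) {B' B'' : ZdEdge d → 𝔸}
    {c : ZdEdge d} (hB : ∀ b ∈ qppBonds L c, B' b = B'' b) : Qtilde L 𝒯 V B' c = Qtilde L 𝒯 V B'' c := by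
  unfold Qtilde
  rw [avgM_congr hL h𝒯 (U := pert B' V) (U' := pert B'' V) fun b hb => by rw [pert_apply, pert_apply, hB b hb]]

/-- [cite: Balaban1987RG1, p.267] **`LQ̃_V` IS `B(c₋) ∪ B(c₊)`-LOCAL** (`B12HOperator267.IsQppLocal`, the hypothesis
`h𝒬` of `B12HOperatorNeumann267.h_paragraph_p267_mainTerm`) — inherited from the locality of `M_c`, no
differentiability needed. -/
theorem isQppLocal_LQ (hL : 0 < L) (h𝒯 : IsBlockLocal L 𝒯) (V : ZdEdge d → 𝔸ˣ) :
    IsQppLocal L (LQ L 𝒯 V) := by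
  intro A A' c hAA'
  unfold LQ
  congr 1
  funext s
  exact Qtilde_congr hL h𝒯 V fun b hb => by simp only [Pi.smul_apply, hAA' b hb]

/-! ## § 4  Axis structure along `B′ = s·δ_{b₀(c)}X`: the closed form of the (2.4)-curve -/

/-- [folklore] the perturbation `B′ = s·δ_{b₀(c)}X` changes only the bond `b₀(c)`. -/
theorem pert_single_of_ne (V : ZdEdge d → 𝔸ˣ) (c : ZdEdge d) (X : 𝔸) (s : ℂ) {b : ZdEdge d} (hb : b ≠ b0Z L c) :
    pert (s • Pi.single (b0Z L c) X) V b = V b :=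
  pert_apply_of_eq_zero V (by simp [Pi.single_eq_of_ne hb])

/-- [folklore] … and at `b₀(c)` it is `exp(isX)·V(b₀(c))`. -/
theorem pert_single_self (V : ZdEdge d → 𝔸ˣ) (c : ZdEdge d) (X : 𝔸) (s : ℂ) :
    pert (s • Pi.single (b0Z L c) X) V (b0Z L c) = expU (Complex.I • s • X) * V (b0Z L c) := by
  rw [pert_apply]; simp

/-- [folklore] `g(c)` does not see `b₀(c)` (its `L − 1` bonds precede `b₀(c)` on the axis line). -/
theorem gcorner_pert_single (V : ZdEdge d → 𝔸ˣ) (c : ZdEdge d) (X : 𝔸) (s : ℂ) :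
    gcorner L (pert (s • Pi.single (b0Z L c) X) V) c = gcorner L V c := by
  unfold gcorner
  refine lineR_congr fun t ht => pert_single_of_ne V c X s fun h => ?_
  have h1 := congr_fun (congrArg Prod.fst h) c.2
  simp only [b0Z, Pi.add_apply, Pi.single_eq_same] at h1
  omega

/-- [folklore] `U(c)` along the perturbation: `U_s(c) = g(c)·exp(isX)·V(b₀(c))`. -/
theorem Ustr_pert_single (hL : 0 < L) (V : ZdEdge d → 𝔸ˣ) (c : ZdEdge d) (X : 𝔸) (s : ℂ) :
    Ustr L (pert (s • Pi.single (b0Z L c) X) V) c = gcorner L V c * expU (Complex.I • s • X) * V (b0Z L c) := by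
  rw [Ustr_eq_gcorner_mul hL, gcorner_pert_single, pert_single_self, mul_assoc]

/-- [folklore] the transporters of the family do not see `b₀(c)` on `B(c₋)` … -/
theorem transporter_pert_single_fst (hL : 0 < L) (h𝒯 : IsBlockLocal L 𝒯) (V : ZdEdge d → 𝔸ˣ) (c : ZdEdge d)
    (X : 𝔸) (s : ℂ) {x : Fin d → ℤ} (hx : x ∈ blockSites L c.1) :
    𝒯 (pert (s • Pi.single (b0Z L c) X) V) x = 𝒯 V x := by
  refine h𝒯 _ _ c.1 x hx fun b hb1 hb2 => pert_single_of_ne V c X s ?_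
  rintro rfl
  exact b0Z_snd_not_mem hL c hb2

/-- [folklore] … nor on `B(c₊)`. -/
theorem transporter_pert_single_snd (hL : 0 < L) (h𝒯 : IsBlockLocal L 𝒯) (V : ZdEdge d → 𝔸ˣ) (c : ZdEdge d)
    (X : 𝔸) (s : ℂ) {x : Fin d → ℤ} (hx : x ∈ blockSites L c.1) :
    𝒯 (pert (s • Pi.single (b0Z L c) X) V) (x + Pi.single c.2 (L : ℤ)) = 𝒯 V (x + Pi.single c.2 (L : ℤ)) := by
  refine h𝒯 _ _ (c.1 + Pi.single c.2 1) _ (add_mem_blockSites_succ hL c.2 hx)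
    fun b hb1 hb2 => pert_single_of_ne V c X s ?_
  rintro rfl
  exact b0Z_fst_not_mem hL c hb1

/-- [cite: Balaban1987RG1, p.252] («[x, x′] … obtained by a parallel transport of c to the point x») off the axis
line the segment `[x, x′]` does not contain `b₀(c)` (`B12HOperator267.bond_eq_b0Z_iff`), so its holonomy is not
perturbed. -/
theorem lineR_pert_single_of_mem_offAxis (V : ZdEdge d → 𝔸ˣ) (c : ZdEdge d) (X : 𝔸) (s : ℂ) {x : Fin d → ℤ}
    (hx : x ∈ offAxis L c) : lineR (pert (s • Pi.single (b0Z L c) X) V) x c.2 L = lineR V x c.2 L :=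
  lineR_congr fun t ht => pert_single_of_ne V c X s fun h =>
    ne_axisSite_of_mem_offAxis hx ht ((bond_eq_b0Z_iff L c x t).1 h)

/-- [folklore] **the off-axis loops along the perturbation**: `W_x(V′_sV) = W_x(V)·(g(c) e^{−isX} g(c)⁻¹)` in `𝔸ˣ`
(only the returning leg `U(c)⁻¹` sees `b₀(c)`). -/
theorem loopW_pert_single_of_mem_offAxis (hL : 0 < L) (h𝒯 : IsBlockLocal L 𝒯) (V : ZdEdge d → 𝔸ˣ) (c : ZdEdge d)
    (X : 𝔸) (s : ℂ) {x : Fin d → ℤ} (hx : x ∈ offAxis L c) :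
    loopW L 𝒯 (pert (s • Pi.single (b0Z L c) X) V) c x
      = loopW L 𝒯 V c x * (gcorner L V c * (expU (Complex.I • s • X))⁻¹ * (gcorner L V c)⁻¹) := by
  have hxB := mem_blockSites_of_mem_offAxis hx
  rw [loopW_def, loopW_def, transporter_pert_single_fst hL h𝒯 V c X s hxB,
    transporter_pert_single_snd hL h𝒯 V c X s hxB, lineR_pert_single_of_mem_offAxis V c X s hx,
    Ustr_pert_single hL, Ustr_eq_gcorner_mul hL]
  group

/-- [folklore] `Ad_{g(c)}`-conjugate of the direction: `X̃ = g(c) X g(c)⁻¹` (`B7Eq78Linearization.conjR`, [B7] (56)). -/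
theorem val_conj_expU_inv (P : 𝔸ˣ) (X : 𝔸) (s : ℂ) :
    ((P * (expU (Complex.I • s • X))⁻¹ * P⁻¹ : 𝔸ˣ) : 𝔸) = exp (s • (-(Complex.I • conjR P X))) := by
  rw [Units.val_mul, Units.val_mul, val_inv_expU, ← exp_conj_units]
  congr 1
  simp only [conjR_apply, smul_neg, mul_neg, neg_mul, ← smul_assoc, smul_eq_mul, mul_smul_comm, smul_mul_assoc,
    mul_comm s Complex.I]

/-- [folklore] the exponent of `M_c` along the perturbation, SPLIT: the axis terms vanish, the off-axis ones are
`L⁻ᵈ log(W_x(V) e^{−isX̃})`. -/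
theorem exponent_pert_single (hL : 0 < L) (h𝒯 : IsBlockLocal L 𝒯) (h𝒯' : IsAxisStraightFamily L 𝒯)
    (V : ZdEdge d → 𝔸ˣ) (c : ZdEdge d) (X : 𝔸) (s : ℂ) :
    ∑ x ∈ blockSites L c.1, ((L : ℂ) ^ d)⁻¹ • mlog ((loopW L 𝒯 (pert (s • Pi.single (b0Z L c) X) V) c x : 𝔸ˣ) : 𝔸)
      = ∑ x ∈ offAxis L c, ((L : ℂ) ^ d)⁻¹ •
          mlog (((loopW L 𝒯 V c x : 𝔸ˣ) : 𝔸) * exp (s • (-(Complex.I • conjR (gcorner L V c) X)))) := by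
  rw [sum_blockSites_eq hL, sum_eq_zero fun l hl => ?_, zero_add]
  · refine sum_congr rfl fun x hx => ?_
    rw [loopW_pert_single_of_mem_offAxis hL h𝒯 V c X s hx, Units.val_mul, val_conj_expU_inv]
  · rw [loopW_axisSite h𝒯' _ c (mem_range.1 hl), Units.val_one, mlog_one, smul_zero]

/-- [folklore] the exponent `Y(c) = Σ_{x∉axis} L⁻ᵈ log W_x(V)` of `M_c(V)` (axis loops dropped, they are `1`). -/
def Yexp (L : ℕ) (𝒯 : (ZdEdge d → 𝔸ˣ) → (Fin d → ℤ) → 𝔸ˣ) (V : ZdEdge d → 𝔸ˣ) (c : ZdEdge d) : 𝔸 :=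
  ∑ x ∈ offAxis L c, ((L : ℂ) ^ d)⁻¹ • mlog ((loopW L 𝒯 V c x : 𝔸ˣ) : 𝔸)

/-- [folklore] the exponent along the perturbation as a function of `s`. -/
def Eexp (L : ℕ) (𝒯 : (ZdEdge d → 𝔸ˣ) → (Fin d → ℤ) → 𝔸ˣ) (V : ZdEdge d → 𝔸ˣ) (c : ZdEdge d) (X : 𝔸) (s : ℂ) : 𝔸 :=
  ∑ x ∈ offAxis L c, ((L : ℂ) ^ d)⁻¹ •
    mlog (((loopW L 𝒯 V c x : 𝔸ˣ) : 𝔸) * exp (s • (-(Complex.I • conjR (gcorner L V c) X))))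

omit [CompleteSpace 𝔸] in
/-- [folklore] `E(0) = Y`. -/
theorem Eexp_zero (L : ℕ) (𝒯 : (ZdEdge d → 𝔸ˣ) → (Fin d → ℤ) → 𝔸ˣ) (V : ZdEdge d → 𝔸ˣ) (c : ZdEdge d) (X : 𝔸) :
    Eexp L 𝒯 V c X 0 = Yexp L 𝒯 V c := by
  simp [Eexp, Yexp]

/-- [cite: Balaban1987RG1, (2.4) p.266] **THE (2.4)-CURVE IN CLOSED FORM**: along `B′ = s·δ_{b₀(c)}X`,
`M_c(V′_sV) M_c(V)⁻¹ = exp[E(s)] · exp(is X̃) · exp(−Y)`. -/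
theorem curve_eq (hL : 0 < L) (h𝒯 : IsBlockLocal L 𝒯) (h𝒯' : IsAxisStraightFamily L 𝒯) (V : ZdEdge d → 𝔸ˣ)
    (c : ZdEdge d) (X : 𝔸) (s : ℂ) :
    ((avgM L 𝒯 (pert (s • Pi.single (b0Z L c) X) V) c * (avgM L 𝒯 V c)⁻¹ : 𝔸ˣ) : 𝔸)
      = exp (Eexp L 𝒯 V c X s) * exp (s • (Complex.I • conjR (gcorner L V c) X)) * exp (-Yexp L 𝒯 V c) := by
  have h0 : avgM L 𝒯 V c = expU (Yexp L 𝒯 V c) * (gcorner L V c * V (b0Z L c)) := by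
    have h := exponent_pert_single hL h𝒯 h𝒯' V c X 0
    rw [zero_smul, pert_zero] at h
    unfold avgM
    rw [h, Ustr_eq_gcorner_mul hL, ← Eexp, Eexp_zero]
  have h1 : avgM L 𝒯 (pert (s • Pi.single (b0Z L c) X) V) c
      = expU (Eexp L 𝒯 V c X s) * (gcorner L V c * expU (Complex.I • s • X) * V (b0Z L c)) := by
    unfold avgM
    rw [exponent_pert_single hL h𝒯 h𝒯' V c X s, Ustr_pert_single hL, ← Eexp]
  rw [h1, h0]
  have hg : expU (Eexp L 𝒯 V c X s) * (gcorner L V c * expU (Complex.I • s • X) * V (b0Z L c)) *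
      (expU (Yexp L 𝒯 V c) * (gcorner L V c * V (b0Z L c)))⁻¹
      = expU (Eexp L 𝒯 V c X s) * (gcorner L V c * expU (Complex.I • s • X) * (gcorner L V c)⁻¹) *
        (expU (Yexp L 𝒯 V c))⁻¹ := by group
  rw [hg, Units.val_mul, Units.val_mul, val_expU, val_inv_expU, Units.val_mul, Units.val_mul, val_expU,
    ← exp_conj_units]
  congr 2
  simp only [conjR_apply, ← smul_assoc, smul_eq_mul, mul_smul_comm, smul_mul_assoc, mul_comm s Complex.I]

end Average

/-! ## § 5  The derivative of the (2.4)-curve: the corridor coefficient of `LQ̃` in closed form -/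

section Derivative

variable {𝔸 : Type*} [NormedRing 𝔸] [NormedAlgebra ℂ 𝔸] [NormOneClass 𝔸] [CompleteSpace 𝔸]

/-- [folklore] the Fréchet derivative `(D log)_W = Σ_n c_n Σ_{i<n} (W−1)^{n−1−i}(·)(W−1)^i` of the logarithmic
series at a general point `‖W − 1‖ < 1` (`Literature.Analysis.SpecialFunctions.LogFDeriv`, BY NAME). -/
def Dmlog (W : 𝔸) : 𝔸 →L[ℂ] 𝔸 := ∑' n, LogFDeriv.term (W - 1) n

/-- [folklore] the Fréchet derivative `(D exp)_Y` of `exp` at a general point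
(`Literature.Analysis.SpecialFunctions.ExpFDeriv`, BY NAME). -/
def Dexp (Y : 𝔸) : 𝔸 →L[ℂ] 𝔸 := ∑' n, ExpFDeriv.term ℂ Y n

omit [NormOneClass 𝔸] in
/-- [folklore] `D log` at `W`, `‖W − 1‖ < 1` (`LogFDeriv.hasFDerivAt_logOnePlus_sub_one`). -/
theorem hasFDerivAt_mlog {W : 𝔸} (hW : ‖W - 1‖ < 1) : HasFDerivAt (mlog : 𝔸 → 𝔸) (Dmlog W) W := by
  have e : (mlog : 𝔸 → 𝔸) = fun Y => logOnePlus (Y - 1) := funext fun Y => mlog_def Y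
  rw [e]
  exact LogFDeriv.hasFDerivAt_logOnePlus_sub_one hW

/-- [folklore] `D exp` at `Y` (`ExpFDeriv.hasFDerivAt_exp`). -/
theorem hasFDerivAt_exp_Dexp (Y : 𝔸) : HasFDerivAt (exp : 𝔸 → 𝔸) (Dexp Y) Y :=
  ExpFDeriv.hasFDerivAt_exp ℂ Y

omit [NormOneClass 𝔸] in
/-- [folklore] `(D log)_1 = id`. -/
theorem Dmlog_one : Dmlog (1 : 𝔸) = ContinuousLinearMap.id ℂ 𝔸 :=
  (hasFDerivAt_mlog (by rw [sub_self, norm_zero]; exact one_pos)).unique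
    B7Eq78Linearization.hasFDerivAt_mlog_one

/-- [folklore] `(D exp)_0 = id`. -/
theorem Dexp_zero : Dexp (0 : 𝔸) = ContinuousLinearMap.id ℂ 𝔸 := by
  rw [(hasFDerivAt_exp_Dexp (0 : 𝔸)).unique (hasFDerivAt_exp_zero (𝕂 := ℂ) (𝔸 := 𝔸))]
  rfl

variable {L : ℕ} {𝒯 : (ZdEdge d → 𝔸ˣ) → (Fin d → ℤ) → 𝔸ˣ}

/-- [cite: Balaban1987RG1, p.267] **the coefficient at `B′(b₀(c))` in `(LQ̃B′)(c)`, CLOSED FORM** (corner cubes,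
transporter family `𝒯`): with `Y = Σ_{x∉axis} L⁻ᵈ log W_x(V)`, `X̃ = g(c) X g(c)⁻¹`,
`bcoef(c)X = e^{Y} X̃ e^{−Y} − (D exp)_Y(Σ_{x∉axis} L⁻ᵈ (D log)_{W_x}(W_x X̃)) e^{−Y}`. -/
def bcoefVal (L : ℕ) (𝒯 : (ZdEdge d → 𝔸ˣ) → (Fin d → ℤ) → 𝔸ˣ) (V : ZdEdge d → 𝔸ˣ) (c : ZdEdge d) (X : 𝔸) : 𝔸 :=
  exp (Yexp L 𝒯 V c) * conjR (gcorner L V c) X * exp (-Yexp L 𝒯 V c)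
    - (Dexp (Yexp L 𝒯 V c))
        (∑ x ∈ offAxis L c, ((L : ℂ) ^ d)⁻¹ •
          (Dmlog ((loopW L 𝒯 V c x : 𝔸ˣ) : 𝔸)) (((loopW L 𝒯 V c x : 𝔸ˣ) : 𝔸) * conjR (gcorner L V c) X))
      * exp (-Yexp L 𝒯 V c)

omit [NormOneClass 𝔸] in
/-- [folklore] `E′(0) = Σ_{x∉axis} L⁻ᵈ (D log)_{W_x}(W_x · (−iX̃))` (chain rule through `log` at the general point
`W_x`, small field `‖W_x − 1‖ < 1` on the off-axis loops). -/
theorem hasDerivAt_Eexp (V : ZdEdge d → 𝔸ˣ) (c : ZdEdge d) (X : 𝔸)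
    (hW : ∀ x ∈ offAxis L c, ‖((loopW L 𝒯 V c x : 𝔸ˣ) : 𝔸) - 1‖ < 1) :
    HasDerivAt (Eexp L 𝒯 V c X)
      (∑ x ∈ offAxis L c, ((L : ℂ) ^ d)⁻¹ •
        (Dmlog ((loopW L 𝒯 V c x : 𝔸ˣ) : 𝔸))
          (((loopW L 𝒯 V c x : 𝔸ˣ) : 𝔸) * -(Complex.I • conjR (gcorner L V c) X))) 0 := by
  have h : Eexp L 𝒯 V c X = fun s => ∑ x ∈ offAxis L c, ((L : ℂ) ^ d)⁻¹ •
      mlog (((loopW L 𝒯 V c x : 𝔸ˣ) : 𝔸) * exp (s • (-(Complex.I • conjR (gcorner L V c) X)))) := rfl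
  rw [h]
  refine HasDerivAt.fun_sum fun x hx => ?_
  refine HasDerivAt.fun_const_smul _ ?_
  have h1 : HasDerivAt
      (fun s : ℂ => ((loopW L 𝒯 V c x : 𝔸ˣ) : 𝔸) * exp (s • (-(Complex.I • conjR (gcorner L V c) X))))
      (((loopW L 𝒯 V c x : 𝔸ˣ) : 𝔸) * -(Complex.I • conjR (gcorner L V c) X)) 0 :=
    (hasDerivAt_exp_smul_zero _).const_mul _
  exact (hasFDerivAt_mlog (hW x hx)).comp_hasDerivAt_of_eq 0 h1 (by rw [zero_smul, exp_zero, mul_one])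

/-- [cite: Balaban1987RG1, (2.4) p.266, p.267] **THE DERIVATIVE OF (2.4) ALONG `B′ = s·δ_{b₀(c)}X`** — the
corridor coefficient of the genuine linearization `LQ̃_V` (kernel `HasDerivAt`; `D exp`, `D log` at general points
BY NAME from `Literature.Analysis.SpecialFunctions`). Hypotheses: `𝒯` block-local and axis-straight, small field
`‖W_x(V) − 1‖ < 1` on the off-axis loops of the block. -/
theorem hasDerivAt_Qtilde_single (hL : 0 < L) (h𝒯 : IsBlockLocal L 𝒯) (h𝒯' : IsAxisStraightFamily L 𝒯)
    (V : ZdEdge d → 𝔸ˣ) (c : ZdEdge d) (X : 𝔸)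
    (hW : ∀ x ∈ offAxis L c, ‖((loopW L 𝒯 V c x : 𝔸ˣ) : 𝔸) - 1‖ < 1) :
    HasDerivAt (fun s : ℂ => Qtilde L 𝒯 V (s • Pi.single (b0Z L c) X) c) (bcoefVal L 𝒯 V c X) 0 := by
  set Y := Yexp L 𝒯 V c with hYdef
  set Xt := conjR (gcorner L V c) X with hXt
  set D₁ := ∑ x ∈ offAxis L c, ((L : ℂ) ^ d)⁻¹ •
        (Dmlog ((loopW L 𝒯 V c x : 𝔸ˣ) : 𝔸))
          (((loopW L 𝒯 V c x : 𝔸ˣ) : 𝔸) * -(Complex.I • Xt)) with hD₁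
  set D := ∑ x ∈ offAxis L c, ((L : ℂ) ^ d)⁻¹ •
          (Dmlog ((loopW L 𝒯 V c x : 𝔸ˣ) : 𝔸)) (((loopW L 𝒯 V c x : 𝔸ˣ) : 𝔸) * Xt) with hD
  have hcurve : (fun s : ℂ => Qtilde L 𝒯 V (s • Pi.single (b0Z L c) X) c)
      = fun s => (-Complex.I) • mlog (exp (Eexp L 𝒯 V c X s) * exp (s • (Complex.I • Xt)) * exp (-Y)) := by
    funext s
    rw [Qtilde, curve_eq hL h𝒯 h𝒯' V c X s]
  rw [hcurve]
  have hE0 : Eexp L 𝒯 V c X 0 = Y := Eexp_zero L 𝒯 V c X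
  have hE : HasDerivAt (Eexp L 𝒯 V c X) D₁ 0 := hasDerivAt_Eexp V c X hW
  have h3 : HasDerivAt (fun s => exp (Eexp L 𝒯 V c X s)) (Dexp Y D₁) 0 :=
    (hasFDerivAt_exp_Dexp Y).comp_hasDerivAt_of_eq 0 hE hE0.symm
  have h4 : HasDerivAt (fun s : ℂ => exp (s • (Complex.I • Xt))) (Complex.I • Xt) 0 := hasDerivAt_exp_smul_zero _
  have h5 : HasDerivAt (fun s => exp (Eexp L 𝒯 V c X s) * exp (s • (Complex.I • Xt)) * exp (-Y))
      ((Dexp Y D₁ * exp ((0 : ℂ) • (Complex.I • Xt)) + exp (Eexp L 𝒯 V c X 0) * (Complex.I • Xt)) * exp (-Y)) 0 :=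
    (h3.fun_mul h4).mul_const _
  have hYY : exp Y * exp (-Y) = 1 := (expU Y).val_inv
  have hF0 : exp (Eexp L 𝒯 V c X 0) * exp ((0 : ℂ) • (Complex.I • Xt)) * exp (-Y) = 1 := by
    rw [hE0, zero_smul, exp_zero, mul_one, hYY]
  have h6 := (hasDerivAt_mlog_comp hF0 h5).fun_const_smul (-Complex.I)
  refine h6.congr_deriv ?_
  rw [zero_smul, exp_zero, mul_one, hE0]
  have hD₁D : D₁ = (-Complex.I) • D := by
    rw [hD₁, hD, smul_sum]
    refine sum_congr rfl fun x _ => ?_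
    rw [mul_neg, mul_smul_comm, ← neg_smul, map_smul]
    exact smul_comm _ _ _
  rw [hD₁D, map_smul, bcoefVal, ← hYdef, ← hXt, ← hD]
  simp only [add_mul, smul_add, mul_smul_comm, smul_mul_assoc, smul_smul, neg_mul, mul_neg, Complex.I_mul_I,
    neg_neg, one_smul, neg_one_smul]
  abel

/-- [cite: Balaban1987RG1, p.267] **`bcoef(c)` of `LQ̃_V` = the closed form** (`B12HOperator267.bcoef` of the
genuine linearization, by `HasDerivAt.deriv`). -/
theorem bcoef_LQ (hL : 0 < L) (h𝒯 : IsBlockLocal L 𝒯) (h𝒯' : IsAxisStraightFamily L 𝒯) (V : ZdEdge d → 𝔸ˣ)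
    (c : ZdEdge d) (X : 𝔸) (hW : ∀ x ∈ offAxis L c, ‖((loopW L 𝒯 V c x : 𝔸ˣ) : 𝔸) - 1‖ < 1) :
    bcoef L (LQ L 𝒯 V) c X = bcoefVal L 𝒯 V c X := by
  simp only [bcoef, LQ]
  exact (hasDerivAt_Qtilde_single hL h𝒯 h𝒯' V c X hW).deriv

/-! ## § 6  `bcoef = coef − S(c)`: the main term of `B12HOperator267` and the explicit correction -/

/-- [cite: Balaban1985Averaging, (56) p.27] `Ad_P = R(P)` as a continuous linear map. -/
def AdU (P : 𝔸ˣ) : 𝔸 →L[ℂ] 𝔸 := ContinuousLinearMap.mulLeftRight ℂ 𝔸 (P : 𝔸) ((P⁻¹ : 𝔸ˣ) : 𝔸)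

omit [NormOneClass 𝔸] [CompleteSpace 𝔸] in
/-- [folklore] unfolding. -/
@[simp] theorem AdU_apply (P : 𝔸ˣ) (X : 𝔸) : AdU P X = (P : 𝔸) * X * ((P⁻¹ : 𝔸ˣ) : 𝔸) := by
  simp [AdU]

/-- [folklore] `Ψ_W := (D log)_W ∘ (W · )` — the loop factor of the correction. -/
def PsiW (W : 𝔸) : 𝔸 →L[ℂ] 𝔸 := (Dmlog W).comp (ContinuousLinearMap.mul ℂ 𝔸 W)

omit [NormOneClass 𝔸] [CompleteSpace 𝔸] in
/-- [folklore] unfolding. -/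
@[simp] theorem PsiW_apply (W X : 𝔸) : PsiW W X = Dmlog W (W * X) := by
  simp [PsiW]

/-- [folklore] `Φ_Y := (· e^{−Y}) ∘ (D exp)_Y` — the exponential factor of the correction. -/
def PhiY (Y : 𝔸) : 𝔸 →L[ℂ] 𝔸 := (ContinuousLinearMap.mulLeftRight ℂ 𝔸 (1 : 𝔸) (exp (-Y))).comp (Dexp Y)

omit [NormOneClass 𝔸] [CompleteSpace 𝔸] in
/-- [folklore] unfolding. -/
@[simp] theorem PhiY_apply (Y X : 𝔸) : PhiY Y X = Dexp Y X * exp (-Y) := by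
  simp [PhiY]

/-- [cite: Balaban1987RG1, p.267] the corridor coefficient of `LQ̃_V` as a continuous linear map:
`bcoefL = (Ad_{e^Y} − Φ_Y ∘ Σ_{x∉axis} L⁻ᵈ Ψ_{W_x}) ∘ Ad_{g(c)}`. -/
def bcoefL (L : ℕ) (𝒯 : (ZdEdge d → 𝔸ˣ) → (Fin d → ℤ) → 𝔸ˣ) (V : ZdEdge d → 𝔸ˣ) (c : ZdEdge d) : 𝔸 →L[ℂ] 𝔸 :=
  (AdU (expU (Yexp L 𝒯 V c))
      - (PhiY (Yexp L 𝒯 V c)).comp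
          (∑ x ∈ offAxis L c, ((L : ℂ) ^ d)⁻¹ • PsiW ((loopW L 𝒯 V c x : 𝔸ˣ) : 𝔸))).comp
    (AdU (gcorner L V c))

omit [NormOneClass 𝔸] in
/-- [folklore] `bcoefL X = bcoefVal X`. -/
theorem bcoefL_apply (L : ℕ) (𝒯 : (ZdEdge d → 𝔸ˣ) → (Fin d → ℤ) → 𝔸ˣ) (V : ZdEdge d → 𝔸ˣ) (c : ZdEdge d)
    (X : 𝔸) : bcoefL L 𝒯 V c X = bcoefVal L 𝒯 V c X := by
  simp [bcoefL, bcoefVal, conjR_apply, Finset.sum_mul]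

/-- [cite: Balaban1987RG1, p.267] **THE MAIN TERM** `K(c) = L^{1−d} Ad_{g(c)}` («h(c) … equal to an inverse of a
coefficient at the variable B′(b₀(c)) …, multiplied by L⁻¹»; `= B12HOperator267.coef` under axis straightness,
`coefL_apply_eq_coef`) as a continuous linear map. -/
def coefL (L : ℕ) (V : ZdEdge d → 𝔸ˣ) (c : ZdEdge d) : 𝔸 →L[ℂ] 𝔸 := (((L : ℂ) ^ d)⁻¹ * L) • AdU (gcorner L V c)

omit [NormOneClass 𝔸] [CompleteSpace 𝔸] in
/-- [folklore] unfolding. -/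
@[simp] theorem coefL_apply (L : ℕ) (V : ZdEdge d → 𝔸ˣ) (c : ZdEdge d) (X : 𝔸) :
    coefL L V c X = (((L : ℂ) ^ d)⁻¹ * L) • (((gcorner L V c : 𝔸ˣ) : 𝔸) * X * (((gcorner L V c)⁻¹ : 𝔸ˣ) : 𝔸)) := by
  simp [coefL]

/-- [folklore] **THE CORRECTION `S(c) := coef − bcoef`** (real-linear, the `S` of
`B12HOperatorNeumann267.h_paragraph_p267_mainTerm`), EXPLICIT:
`S(c) = [L^{1−d}·1 − Ad_{e^Y} + Φ_Y ∘ Σ_{x∉axis} L⁻ᵈ Ψ_{W_x}] ∘ Ad_{g(c)}`. -/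
def Scorr (L : ℕ) (𝒯 : (ZdEdge d → 𝔸ˣ) → (Fin d → ℤ) → 𝔸ˣ) (V : ZdEdge d → 𝔸ˣ) (c : ZdEdge d) : 𝔸 →L[ℝ] 𝔸 :=
  (coefL L V c - bcoefL L 𝒯 V c).restrictScalars ℝ

omit [NormOneClass 𝔸] in
/-- [folklore] unfolding. -/
theorem Scorr_apply (L : ℕ) (𝒯 : (ZdEdge d → 𝔸ˣ) → (Fin d → ℤ) → 𝔸ˣ) (V : ZdEdge d → 𝔸ˣ) (c : ZdEdge d)
    (X : 𝔸) : Scorr L 𝒯 V c X = coefL L V c X - bcoefL L 𝒯 V c X := rfl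

/-- [folklore] the transporters read in `ConjAct 𝔸ˣ` (the carrier of `B12HOperator267.coef`: `G = ConjAct Aˣ`
acting on `A` by conjugation). -/
def Tconj (𝒯 : (ZdEdge d → 𝔸ˣ) → (Fin d → ℤ) → 𝔸ˣ) (V : ZdEdge d → 𝔸ˣ) : (Fin d → ℤ) → ConjAct 𝔸ˣ :=
  fun x => ConjAct.toConjAct (𝒯 V x)

/-- [folklore] the bond variables read in `ConjAct 𝔸ˣ`. -/
def Rconj (V : ZdEdge d → 𝔸ˣ) : ZdEdge d → ConjAct 𝔸ˣ := fun b => ConjAct.toConjAct (V b)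

omit [NormedAlgebra ℂ 𝔸] [NormOneClass 𝔸] [CompleteSpace 𝔸] in
/-- [folklore] axis straightness transfers to `ConjAct`. -/
theorem axisStraight_conj (h𝒯' : IsAxisStraightFamily L 𝒯) (V : ZdEdge d → 𝔸ˣ) :
    AxisStraight L (Tconj 𝒯 V) (Rconj V) := by
  intro y μ t ht
  show ConjAct.toConjAct (𝒯 V (blockBase L y + Pi.single μ (t : ℤ)))
    = lineR (fun b => ConjAct.toConjAct (V b)) (blockBase L y) μ t
  rw [h𝒯' V y μ t ht, map_lineR]

omit [NormedAlgebra ℂ 𝔸] [NormOneClass 𝔸] [CompleteSpace 𝔸] in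
/-- [folklore] bond norms transfer. -/
theorem norm_Rconj_le {V : ZdEdge d → 𝔸ˣ} (hV : ∀ b, ‖((V b : 𝔸ˣ) : 𝔸)‖ ≤ 1) (b : ZdEdge d) :
    ‖((ConjAct.ofConjAct (Rconj V b) : 𝔸ˣ) : 𝔸)‖ ≤ 1 := by
  simpa [Rconj] using hV b

omit [NormedAlgebra ℂ 𝔸] [NormOneClass 𝔸] [CompleteSpace 𝔸] in
/-- [folklore] inverse bond norms transfer. -/
theorem norm_Rconj_inv_le {V : ZdEdge d → 𝔸ˣ} (hV' : ∀ b, ‖(((V b)⁻¹ : 𝔸ˣ) : 𝔸)‖ ≤ 1) (b : ZdEdge d) :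
    ‖(((ConjAct.ofConjAct (Rconj V b))⁻¹ : 𝔸ˣ) : 𝔸)‖ ≤ 1 := by
  simpa [Rconj] using hV' b

omit [NormOneClass 𝔸] [CompleteSpace 𝔸] in
/-- [cite: Balaban1987RG1, p.267] `coef` of `B12HOperator267` (the printed «coefficient … multiplied by L⁻¹» under
axis straightness, `coef_eq_of_axisStraight`) is `coefL`. -/
theorem coefL_apply_eq_coef (h𝒯' : IsAxisStraightFamily L 𝒯) (V : ZdEdge d → 𝔸ˣ) (c : ZdEdge d)
    (X : 𝔸) : coefL L V c X = coef L (Tconj 𝒯 V) (Rconj V) c X := by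
  rw [coef_eq_of_axisStraight (axisStraight_conj h𝒯' V)]
  have hg : gcorner L (Rconj V) c = ConjAct.toConjAct (gcorner L V c) := by
    show lineR (fun b => ConjAct.toConjAct (V b)) (blockBase L c.1) c.2 (L - 1) = _
    rw [← map_lineR]
    rfl
  rw [hg, conjAct_smul_eq, ConjAct.ofConjAct_toConjAct, coefL_apply, ← Complex.coe_smul]
  push_cast
  rfl

/-- [cite: Balaban1987RG1, p.267] **`bcoef = coef − S(c)`** — the hypothesis `hK` of
`B12HOperatorNeumann267.h_paragraph_p267_mainTerm` for the genuine linearization `𝒬 = LQ̃_V`, with the EXPLICIT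
`S = Scorr` (small field on the off-axis loops). -/
theorem bcoef_LQ_eq_coef_sub (hL : 0 < L) (h𝒯 : IsBlockLocal L 𝒯) (h𝒯' : IsAxisStraightFamily L 𝒯)
    (V : ZdEdge d → 𝔸ˣ) (c : ZdEdge d) (X : 𝔸)
    (hW : ∀ x ∈ offAxis L c, ‖((loopW L 𝒯 V c x : 𝔸ˣ) : 𝔸) - 1‖ < 1) :
    bcoef L (LQ L 𝒯 V) c X = coef L (Tconj 𝒯 V) (Rconj V) c X - Scorr L 𝒯 V c X := by
  rw [Scorr_apply, coefL_apply_eq_coef h𝒯' V c X, sub_sub_cancel, bcoefL_apply,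
    bcoef_LQ hL h𝒯 h𝒯' V c X hW]

/-! ## § 6b  Exactness of the main term at flat loops -/

/-- [folklore] **`S(c) = 0` when all the loops of the block are `1`** (`Y = 0`, `(D exp)_0 = (D log)_1 = id`,
`#offAxis = Lᵈ − L`): the main term `L^{1−d} Ad_{g(c)}` IS the corridor coefficient for a configuration whose
block loops are flat (in particular for the trivial configuration). -/
theorem Scorr_eq_zero_of_flat (hL : 0 < L) (V : ZdEdge d → 𝔸ˣ) (c : ZdEdge d)
    (hflat : ∀ x ∈ offAxis L c, loopW L 𝒯 V c x = 1) : Scorr L 𝒯 V c = 0 := by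
  have hY : Yexp L 𝒯 V c = 0 :=
    sum_eq_zero fun x hx => by rw [hflat x hx, Units.val_one, mlog_one, smul_zero]
  have hLd : ((L : ℂ) ^ d) ≠ 0 := pow_ne_zero _ (Nat.cast_ne_zero.2 hL.ne')
  have hcard : ((offAxis L c).card : ℂ) = (L : ℂ) ^ d - L := by
    rw [card_offAxis hL, Nat.cast_sub (Nat.le_self_pow (Fin.pos c.2).ne' L), Nat.cast_pow]
  refine ContinuousLinearMap.ext fun X => ?_
  rw [show (0 : 𝔸 →L[ℝ] 𝔸) X = 0 from rfl, Scorr_apply, bcoefL_apply, bcoefVal, hY, coefL_apply,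
    sum_congr rfl fun x hx => by
      rw [hflat x hx, Units.val_one, Dmlog_one, one_mul, ContinuousLinearMap.id_apply],
    ← Finset.sum_smul, sum_const, nsmul_eq_mul, hcard, neg_zero, exp_zero, one_mul, mul_one, Dexp_zero,
    ContinuousLinearMap.id_apply, conjR_apply, mul_one]
  have hr : ((L : ℂ) ^ d)⁻¹ * L = 1 - ((L : ℂ) ^ d - L) * ((L : ℂ) ^ d)⁻¹ := by
    field_simp
    ring
  rw [hr, sub_smul, one_smul, sub_self]

end Derivative

/-! ## § 7  Norm bounds: `‖S(c)‖ ≤ δ_A + δ_Φ(1 + δ_Ψ) + δ_Ψ ≤ 24ε` under the loop small field -/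

section Norms

variable {𝔸 : Type*} [NormedRing 𝔸] [NormedAlgebra ℂ 𝔸] [NormOneClass 𝔸] [CompleteSpace 𝔸]

omit [NormOneClass 𝔸] [CompleteSpace 𝔸] in
/-- [folklore] the first term of the derivative series of `exp` is the identity. -/
theorem expTerm_one (Y : 𝔸) : ExpFDeriv.term ℂ Y 1 = ContinuousLinearMap.id ℂ 𝔸 := by
  ext h
  simp [ExpFDeriv.term_apply]

/-- [folklore] `(D exp)_Y − id` is the tail `Σ' n, term Y (n + 2)`. -/
theorem Dexp_sub_one (Y : 𝔸) : Dexp Y - 1 = ∑' n, ExpFDeriv.term ℂ Y (n + 2) := by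
  have h2 := (ExpFDeriv.summable_term ℂ Y).sum_add_tsum_nat_add 2
  rw [Finset.sum_range_succ, Finset.sum_range_one, ExpFDeriv.term_zero, expTerm_one, zero_add] at h2
  rw [Dexp, ← h2, ContinuousLinearMap.one_def, add_sub_cancel_left]

/-- [folklore] **`‖(D exp)_Y − id‖ ≤ e^{‖Y‖} − 1`**. -/
theorem norm_Dexp_sub_one_le (Y : 𝔸) : ‖Dexp Y - 1‖ ≤ Real.exp ‖Y‖ - 1 := by
  rw [Dexp_sub_one]
  have h := (hasSum_nat_add_iff' 2).mpr (ExpFDeriv.hasSum_bound ‖Y‖)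
  refine (tsum_of_norm_bounded h fun n => ExpFDeriv.norm_term_le ℂ le_rfl _).trans_eq ?_
  norm_num [Finset.sum_range_succ]

omit [NormOneClass 𝔸] in
/-- [folklore] `Ad_{e^Y} − 1 = (e^Y − 1)(·)e^{−Y} + (·)(e^{−Y} − 1)`. -/
theorem AdU_expU_sub_one (Y : 𝔸) : AdU (expU Y) - 1
    = ContinuousLinearMap.mulLeftRight ℂ 𝔸 (exp Y - 1) (exp (-Y))
      + ContinuousLinearMap.mulLeftRight ℂ 𝔸 1 (exp (-Y) - 1) := by
  ext X
  simp [mul_assoc]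

/-- [folklore] **`δ_A`: `‖Ad_{e^Y} − 1‖ ≤ e^{2‖Y‖} − 1`**. -/
theorem norm_AdU_expU_sub_one_le (Y : 𝔸) : ‖AdU (expU Y) - 1‖ ≤ Real.exp (2 * ‖Y‖) - 1 := by
  have hη' : ‖exp (-Y)‖ ≤ Real.exp ‖Y‖ := by simpa using QuantumLattice.norm_exp_le ℂ (-Y)
  have h1 := norm_exp_sub_one_le Y
  have h2 : ‖exp (-Y) - 1‖ ≤ Real.exp ‖Y‖ - 1 := by simpa using norm_exp_sub_one_le (-Y)
  have h0 : 0 ≤ Real.exp ‖Y‖ - 1 := sub_nonneg.2 (Real.one_le_exp (norm_nonneg Y))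
  rw [AdU_expU_sub_one]
  calc ‖ContinuousLinearMap.mulLeftRight ℂ 𝔸 (exp Y - 1) (exp (-Y))
          + ContinuousLinearMap.mulLeftRight ℂ 𝔸 1 (exp (-Y) - 1)‖
        ≤ ‖ContinuousLinearMap.mulLeftRight ℂ 𝔸 (exp Y - 1) (exp (-Y))‖
          + ‖ContinuousLinearMap.mulLeftRight ℂ 𝔸 1 (exp (-Y) - 1)‖ := norm_add_le _ _
    _ ≤ ‖exp Y - 1‖ * ‖exp (-Y)‖ + ‖(1 : 𝔸)‖ * ‖exp (-Y) - 1‖ :=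
        add_le_add (ContinuousLinearMap.opNorm_mulLeftRight_apply_apply_le _ _ _ _)
          (ContinuousLinearMap.opNorm_mulLeftRight_apply_apply_le _ _ _ _)
    _ ≤ (Real.exp ‖Y‖ - 1) * Real.exp ‖Y‖ + 1 * (Real.exp ‖Y‖ - 1) := by
        rw [norm_one]
        exact add_le_add (mul_le_mul h1 hη' (norm_nonneg _) h0) (mul_le_mul_of_nonneg_left h2 zero_le_one)
    _ = Real.exp (2 * ‖Y‖) - 1 := by rw [two_mul, Real.exp_add]; ring

omit [NormOneClass 𝔸] [CompleteSpace 𝔸] in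
/-- [folklore] `Φ_Y − 1 = [(·)e^{−Y}] ∘ ((D exp)_Y − 1) + (·)(e^{−Y} − 1)`. -/
theorem PhiY_sub_one (Y : 𝔸) : PhiY Y - 1
    = (ContinuousLinearMap.mulLeftRight ℂ 𝔸 1 (exp (-Y))).comp (Dexp Y - 1)
      + ContinuousLinearMap.mulLeftRight ℂ 𝔸 1 (exp (-Y) - 1) := by
  ext X
  simp [PhiY]

/-- [folklore] **`δ_Φ`: `‖Φ_Y − 1‖ ≤ e^{2‖Y‖} − 1`**. -/
theorem norm_PhiY_sub_one_le (Y : 𝔸) : ‖PhiY Y - 1‖ ≤ Real.exp (2 * ‖Y‖) - 1 := by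
  have hη' : ‖exp (-Y)‖ ≤ Real.exp ‖Y‖ := by simpa using QuantumLattice.norm_exp_le ℂ (-Y)
  have h1 := norm_Dexp_sub_one_le Y
  have h2 : ‖exp (-Y) - 1‖ ≤ Real.exp ‖Y‖ - 1 := by simpa using norm_exp_sub_one_le (-Y)
  have h0 : 0 ≤ Real.exp ‖Y‖ - 1 := sub_nonneg.2 (Real.one_le_exp (norm_nonneg Y))
  rw [PhiY_sub_one]
  calc ‖(ContinuousLinearMap.mulLeftRight ℂ 𝔸 1 (exp (-Y))).comp (Dexp Y - 1)
          + ContinuousLinearMap.mulLeftRight ℂ 𝔸 1 (exp (-Y) - 1)‖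
        ≤ ‖(ContinuousLinearMap.mulLeftRight ℂ 𝔸 1 (exp (-Y))).comp (Dexp Y - 1)‖
          + ‖ContinuousLinearMap.mulLeftRight ℂ 𝔸 1 (exp (-Y) - 1)‖ := norm_add_le _ _
    _ ≤ ‖(1 : 𝔸)‖ * ‖exp (-Y)‖ * ‖Dexp Y - 1‖ + ‖(1 : 𝔸)‖ * ‖exp (-Y) - 1‖ :=
        add_le_add ((ContinuousLinearMap.opNorm_comp_le _ _).trans (mul_le_mul_of_nonneg_right
            (ContinuousLinearMap.opNorm_mulLeftRight_apply_apply_le _ _ _ _) (norm_nonneg _)))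
          (ContinuousLinearMap.opNorm_mulLeftRight_apply_apply_le _ _ _ _)
    _ ≤ 1 * Real.exp ‖Y‖ * (Real.exp ‖Y‖ - 1) + 1 * (Real.exp ‖Y‖ - 1) := by
        rw [norm_one, one_mul, one_mul, one_mul, one_mul]
        exact add_le_add (mul_le_mul hη' h1 (norm_nonneg _) (Real.exp_pos _).le) h2
    _ = Real.exp (2 * ‖Y‖) - 1 := by rw [two_mul, Real.exp_add]; ring

omit [NormOneClass 𝔸] [CompleteSpace 𝔸] in
/-- [folklore] `Ψ_W − 1 = ((D log)_W − 1) ∘ (W ·) + ((W − 1) ·)`. -/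
theorem PsiW_sub_one (W : 𝔸) : PsiW W - 1
    = (Dmlog W - 1).comp (ContinuousLinearMap.mul ℂ 𝔸 W) + ContinuousLinearMap.mul ℂ 𝔸 (W - 1) := by
  ext X
  simp [PsiW]

/-- [folklore] **`δ_Ψ`: `‖Ψ_W − 1‖ ≤ 4ε`** for `‖W − 1‖ ≤ ε ≤ 1/2` (`LogFDeriv.norm_tsum_term_sub_id_le`:
`‖(D log)_W − 1‖ ≤ ‖W−1‖/(1 − ‖W−1‖)`). -/
theorem norm_PsiW_sub_one_le {W : 𝔸} {ε : ℝ} (hW : ‖W - 1‖ ≤ ε) (hε : ε ≤ 1 / 2) : ‖PsiW W - 1‖ ≤ 4 * ε := by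
  have t0 : 0 ≤ ‖W - 1‖ := norm_nonneg _
  have ht1 : ‖W - 1‖ < 1 := by linarith
  have hD : ‖Dmlog W - 1‖ ≤ ‖W - 1‖ / (1 - ‖W - 1‖) := by
    rw [ContinuousLinearMap.one_def]
    exact LogFDeriv.norm_tsum_term_sub_id_le ht1
  have hWn : ‖W‖ ≤ ‖W - 1‖ + 1 := by
    calc ‖W‖ = ‖(W - 1) + 1‖ := by rw [sub_add_cancel]
      _ ≤ ‖W - 1‖ + ‖(1 : 𝔸)‖ := norm_add_le _ _
      _ = ‖W - 1‖ + 1 := by rw [norm_one]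
  have hfrac : ‖W - 1‖ / (1 - ‖W - 1‖) ≤ 2 * ‖W - 1‖ := by
    rw [div_le_iff₀ (by linarith)]
    nlinarith
  rw [PsiW_sub_one]
  calc ‖(Dmlog W - 1).comp (ContinuousLinearMap.mul ℂ 𝔸 W) + ContinuousLinearMap.mul ℂ 𝔸 (W - 1)‖
        ≤ ‖(Dmlog W - 1).comp (ContinuousLinearMap.mul ℂ 𝔸 W)‖ + ‖ContinuousLinearMap.mul ℂ 𝔸 (W - 1)‖ :=
          norm_add_le _ _
    _ ≤ ‖Dmlog W - 1‖ * ‖W‖ + ‖W - 1‖ :=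
        add_le_add ((ContinuousLinearMap.opNorm_comp_le _ _).trans
            (mul_le_mul_of_nonneg_left (ContinuousLinearMap.opNorm_mul_apply_le _ _ _) (norm_nonneg _)))
          (ContinuousLinearMap.opNorm_mul_apply_le _ _ _)
    _ ≤ (2 * ‖W - 1‖) * (‖W - 1‖ + 1) + ‖W - 1‖ :=
        add_le_add (mul_le_mul (hD.trans hfrac) hWn (norm_nonneg _) (by positivity)) le_rfl
    _ ≤ 4 * ε := by nlinarith

omit [NormOneClass 𝔸] [CompleteSpace 𝔸] in
/-- [folklore] `‖Ψ_W‖ ≤ 1 + ‖Ψ_W − 1‖`. -/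
theorem norm_PsiW_le (W : 𝔸) : ‖PsiW W‖ ≤ 1 + ‖PsiW W - 1‖ := by
  have h1 : ‖(1 : 𝔸 →L[ℂ] 𝔸)‖ ≤ 1 := by
    rw [ContinuousLinearMap.one_def]
    exact ContinuousLinearMap.norm_id_le
  calc ‖PsiW W‖ = ‖1 + (PsiW W - 1)‖ := by rw [add_sub_cancel]
    _ ≤ ‖(1 : 𝔸 →L[ℂ] 𝔸)‖ + ‖PsiW W - 1‖ := norm_add_le _ _
    _ ≤ 1 + ‖PsiW W - 1‖ := by linarith

variable {L : ℕ} {𝒯 : (ZdEdge d → 𝔸ˣ) → (Fin d → ℤ) → 𝔸ˣ}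

omit [NormOneClass 𝔸] [CompleteSpace 𝔸] in
/-- [folklore] the weight of the off-axis sites: `κ = Σ_{x∉axis} L⁻ᵈ = (Lᵈ − L)/Lᵈ ≤ 1`. -/
theorem sum_offAxis_weight_le_one (hL : 0 < L) (c : ZdEdge d) :
    ∑ _x ∈ offAxis L c, ((L : ℝ) ^ d)⁻¹ ≤ 1 := by
  have hLd : (0 : ℝ) < (L : ℝ) ^ d := by positivity
  have hcard : ((offAxis L c).card : ℝ) ≤ (L : ℝ) ^ d := by
    have h := (card_le_card (filter_subset (fun x => x ∉ axisSites L c) (blockSites L c.1))).trans_eq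
      (card_blockSites L c.1)
    exact_mod_cast h
  rw [sum_const, nsmul_eq_mul]
  calc ((offAxis L c).card : ℝ) * ((L : ℝ) ^ d)⁻¹ ≤ (L : ℝ) ^ d * ((L : ℝ) ^ d)⁻¹ :=
        mul_le_mul_of_nonneg_right hcard (inv_nonneg.2 hLd.le)
    _ = 1 := mul_inv_cancel₀ hLd.ne'

omit [NormOneClass 𝔸] [CompleteSpace 𝔸] in
/-- [folklore] `‖L⁻ᵈ • v‖ = L⁻ᵈ ‖v‖` (complex scalar `L⁻ᵈ`). -/
theorem norm_weight_smul {E : Type*} [SeminormedAddCommGroup E] [NormedSpace ℂ E] (v : E) :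
    ‖((L : ℂ) ^ d)⁻¹ • v‖ = ((L : ℝ) ^ d)⁻¹ * ‖v‖ := by
  rw [norm_smul, norm_inv, norm_pow, Complex.norm_natCast]

omit [NormOneClass 𝔸] in
/-- [folklore] **`η`: `‖Y‖ ≤ 2ε`** for `‖W_x − 1‖ ≤ ε ≤ 1/2` on the off-axis loops (`MatrixLog.norm_mlog_le_two_mul`,
`κ ≤ 1`). -/
theorem norm_Yexp_le (hL : 0 < L) (V : ZdEdge d → 𝔸ˣ) (c : ZdEdge d) {ε : ℝ} (hε0 : 0 ≤ ε) (hε : ε ≤ 1 / 2)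
    (hW : ∀ x ∈ offAxis L c, ‖((loopW L 𝒯 V c x : 𝔸ˣ) : 𝔸) - 1‖ ≤ ε) : ‖Yexp L 𝒯 V c‖ ≤ 2 * ε := by
  calc ‖Yexp L 𝒯 V c‖ ≤ ∑ x ∈ offAxis L c, ‖((L : ℂ) ^ d)⁻¹ • mlog ((loopW L 𝒯 V c x : 𝔸ˣ) : 𝔸)‖ :=
        norm_sum_le _ _
    _ ≤ ∑ _x ∈ offAxis L c, ((L : ℝ) ^ d)⁻¹ * (2 * ε) := by
        refine sum_le_sum fun x hx => ?_
        rw [norm_weight_smul]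
        refine mul_le_mul_of_nonneg_left ?_ (by positivity)
        exact (MatrixLog.norm_mlog_le_two_mul ((hW x hx).trans hε)).trans (by linarith [hW x hx])
    _ = (∑ _x ∈ offAxis L c, ((L : ℝ) ^ d)⁻¹) * (2 * ε) := by rw [sum_mul]
    _ ≤ 1 * (2 * ε) := mul_le_mul_of_nonneg_right (sum_offAxis_weight_le_one hL c) (by positivity)
    _ = 2 * ε := one_mul _

omit [NormOneClass 𝔸] in
/-- [folklore] **`S(c)` EXPLICIT AS «MAIN TERM − CORRECTIONS»**:
`coef − bcoef = [(1 − Ad_{e^Y}) + (Φ_Y − 1) ∘ Σ_{x∉axis} L⁻ᵈ Ψ_{W_x} + Σ_{x∉axis} L⁻ᵈ (Ψ_{W_x} − 1)] ∘ Ad_{g(c)}`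
(uses `L^{1−d} = 1 − κ`, `κ = #offAxis · L⁻ᵈ`). -/
theorem coefL_sub_bcoefL (hL : 0 < L) (𝒯 : (ZdEdge d → 𝔸ˣ) → (Fin d → ℤ) → 𝔸ˣ) (V : ZdEdge d → 𝔸ˣ)
    (c : ZdEdge d) :
    coefL L V c - bcoefL L 𝒯 V c
      = ((1 - AdU (expU (Yexp L 𝒯 V c)))
          + (PhiY (Yexp L 𝒯 V c) - 1).comp
              (∑ x ∈ offAxis L c, ((L : ℂ) ^ d)⁻¹ • PsiW ((loopW L 𝒯 V c x : 𝔸ˣ) : 𝔸))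
          + ∑ x ∈ offAxis L c, ((L : ℂ) ^ d)⁻¹ • (PsiW ((loopW L 𝒯 V c x : 𝔸ˣ) : 𝔸) - 1)).comp
        (AdU (gcorner L V c)) := by
  have hLd : ((L : ℂ) ^ d) ≠ 0 := pow_ne_zero _ (Nat.cast_ne_zero.2 hL.ne')
  have hcard : ((offAxis L c).card : ℂ) = (L : ℂ) ^ d - L := by
    rw [card_offAxis hL, Nat.cast_sub (Nat.le_self_pow (Fin.pos c.2).ne' L), Nat.cast_pow]
  have hr : ((L : ℂ) ^ d)⁻¹ * L = 1 - ∑ _x ∈ offAxis L c, ((L : ℂ) ^ d)⁻¹ := by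
    rw [sum_const, nsmul_eq_mul, hcard]
    field_simp
    ring
  have hsplit : ∑ x ∈ offAxis L c, ((L : ℂ) ^ d)⁻¹ • (PsiW ((loopW L 𝒯 V c x : 𝔸ˣ) : 𝔸) - 1)
      = ∑ x ∈ offAxis L c, ((L : ℂ) ^ d)⁻¹ • PsiW ((loopW L 𝒯 V c x : 𝔸ˣ) : 𝔸)
        - (∑ _x ∈ offAxis L c, ((L : ℂ) ^ d)⁻¹) • (1 : 𝔸 →L[ℂ] 𝔸) := by
    have h1 : (∑ _x ∈ offAxis L c, ((L : ℂ) ^ d)⁻¹) • (1 : 𝔸 →L[ℂ] 𝔸)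
        = ∑ _x ∈ offAxis L c, ((L : ℂ) ^ d)⁻¹ • (1 : 𝔸 →L[ℂ] 𝔸) :=
      Finset.sum_smul (R := ℂ) (M := 𝔸 →L[ℂ] 𝔸) (s := offAxis L c) (f := fun _ => ((L : ℂ) ^ d)⁻¹) (x := 1)
    rw [h1, ← Finset.sum_sub_distrib]
    simp only [smul_sub]
  rw [hsplit, coefL, hr]
  set κ : ℂ := ∑ _x ∈ offAxis L c, ((L : ℂ) ^ d)⁻¹
  ext X
  simp [bcoefL, sub_smul, mul_assoc]
  abel

omit [NormOneClass 𝔸] in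
/-- [folklore] **STRUCTURAL BOUND** `‖S(c)‖ ≤ (δ_A + δ_Φ·‖Σ L⁻ᵈ Ψ_x‖ + ‖Σ L⁻ᵈ(Ψ_x − 1)‖)·‖Ad_{g(c)}‖`. -/
theorem norm_Scorr_le_struct (hL : 0 < L) (𝒯 : (ZdEdge d → 𝔸ˣ) → (Fin d → ℤ) → 𝔸ˣ) (V : ZdEdge d → 𝔸ˣ)
    (c : ZdEdge d) :
    ‖Scorr L 𝒯 V c‖
      ≤ (‖AdU (expU (Yexp L 𝒯 V c)) - 1‖
          + ‖PhiY (Yexp L 𝒯 V c) - 1‖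
              * ‖∑ x ∈ offAxis L c, ((L : ℂ) ^ d)⁻¹ • PsiW ((loopW L 𝒯 V c x : 𝔸ˣ) : 𝔸)‖
          + ‖∑ x ∈ offAxis L c, ((L : ℂ) ^ d)⁻¹ • (PsiW ((loopW L 𝒯 V c x : 𝔸ˣ) : 𝔸) - 1)‖)
        * ‖AdU (gcorner L V c)‖ := by
  rw [Scorr, ContinuousLinearMap.norm_restrictScalars, coefL_sub_bcoefL hL]
  refine (ContinuousLinearMap.opNorm_comp_le _ _).trans (mul_le_mul_of_nonneg_right ?_ (norm_nonneg _))
  refine (norm_add₃_le).trans ?_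
  rw [norm_sub_rev]
  exact add_le_add (add_le_add le_rfl (ContinuousLinearMap.opNorm_comp_le _ _)) le_rfl

omit [NormedAlgebra ℂ 𝔸] [CompleteSpace 𝔸] in
/-- [folklore] a product of bond variables of norm `≤ 1` has norm `≤ 1` (`‖1‖ = 1`). -/
theorem norm_val_pathProd_le_one {g : ℕ → 𝔸ˣ} (hg : ∀ t, ‖((g t : 𝔸ˣ) : 𝔸)‖ ≤ 1) (n : ℕ) :
    ‖((pathProd g n : 𝔸ˣ) : 𝔸)‖ ≤ 1 := by
  induction n with
  | zero => rw [pathProd_zero, Units.val_one, norm_one]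
  | succ n ih =>
    rw [pathProd_succ, Units.val_mul]
    exact (norm_mul_le _ _).trans (mul_le_one₀ ih (norm_nonneg _) (hg n))

omit [NormedAlgebra ℂ 𝔸] [CompleteSpace 𝔸] in
/-- [folklore] … and so has its inverse when the inverse bond variables have norm `≤ 1`. -/
theorem norm_inv_pathProd_le_one {g : ℕ → 𝔸ˣ} (hg' : ∀ t, ‖(((g t)⁻¹ : 𝔸ˣ) : 𝔸)‖ ≤ 1) (n : ℕ) :
    ‖(((pathProd g n)⁻¹ : 𝔸ˣ) : 𝔸)‖ ≤ 1 := by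
  induction n with
  | zero => rw [pathProd_zero, inv_one, Units.val_one, norm_one]
  | succ n ih =>
    rw [pathProd_succ, mul_inv_rev, Units.val_mul]
    exact (norm_mul_le _ _).trans (mul_le_one₀ (hg' n) (norm_nonneg _) ih)

omit [NormedAlgebra ℂ 𝔸] [CompleteSpace 𝔸] in
/-- [folklore] `‖g(c)‖ ≤ 1`, `‖g(c)⁻¹‖ ≤ 1` from the bond norms. -/
theorem norm_gcorner_le {V : ZdEdge d → 𝔸ˣ} (hV : ∀ b, ‖((V b : 𝔸ˣ) : 𝔸)‖ ≤ 1)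
    (hV' : ∀ b, ‖(((V b)⁻¹ : 𝔸ˣ) : 𝔸)‖ ≤ 1) (c : ZdEdge d) :
    ‖((gcorner L V c : 𝔸ˣ) : 𝔸)‖ ≤ 1 ∧ ‖(((gcorner L V c)⁻¹ : 𝔸ˣ) : 𝔸)‖ ≤ 1 :=
  ⟨norm_val_pathProd_le_one (fun _ => hV _) _, norm_inv_pathProd_le_one (fun _ => hV' _) _⟩

omit [NormOneClass 𝔸] [CompleteSpace 𝔸] in
/-- [folklore] `‖Ad_P‖ ≤ ‖P‖‖P⁻¹‖ ≤ 1`. -/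
theorem norm_AdU_le_one {P : 𝔸ˣ} (hP : ‖(P : 𝔸)‖ ≤ 1) (hP' : ‖((P⁻¹ : 𝔸ˣ) : 𝔸)‖ ≤ 1) : ‖AdU P‖ ≤ 1 :=
  (ContinuousLinearMap.opNorm_mulLeftRight_apply_apply_le _ _ _ _).trans (mul_le_one₀ hP (norm_nonneg _) hP')

/-- [folklore] `e^{4ε} − 1 ≤ 8ε` for `0 ≤ ε ≤ 1/8` (`Real.abs_exp_sub_one_le`). -/
theorem exp_two_mul_sub_one_le {η ε : ℝ} (hη0 : 0 ≤ η) (hη : η ≤ 2 * ε) (hε : ε ≤ 1 / 8) :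
    Real.exp (2 * η) - 1 ≤ 8 * ε := by
  have h1 : |2 * η| ≤ 1 := by rw [abs_of_nonneg (by linarith)]; linarith
  have h2 := Real.abs_exp_sub_one_le h1
  rw [abs_of_nonneg (by linarith : (0 : ℝ) ≤ 2 * η)] at h2
  have h3 : Real.exp (2 * η) - 1 ≤ 2 * (2 * η) := (le_abs_self _).trans h2
  linarith

/-- [folklore] **THE NUMERICAL BOUND `‖S(c)‖ ≤ 24ε`** under the loop-level small field `‖W_x(V) − 1‖ ≤ ε` on the
off-axis loops of the block, `0 ≤ ε ≤ 1/8`, and `‖g(c)‖, ‖g(c)⁻¹‖ ≤ 1`: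
`δ_A, δ_Φ ≤ e^{4ε} − 1 ≤ 8ε`, `δ_Ψ ≤ 4ε`, `κ ≤ 1`, `8ε + 8ε(1 + 4ε) + 4ε = 20ε + 32ε² ≤ 24ε`. -/
theorem norm_Scorr_le (hL : 0 < L) (𝒯 : (ZdEdge d → 𝔸ˣ) → (Fin d → ℤ) → 𝔸ˣ) (V : ZdEdge d → 𝔸ˣ) (c : ZdEdge d)
    {ε : ℝ} (hε0 : 0 ≤ ε) (hε : ε ≤ 1 / 8) (hW : ∀ x ∈ offAxis L c, ‖((loopW L 𝒯 V c x : 𝔸ˣ) : 𝔸) - 1‖ ≤ ε)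
    (hP : ‖((gcorner L V c : 𝔸ˣ) : 𝔸)‖ ≤ 1) (hP' : ‖(((gcorner L V c)⁻¹ : 𝔸ˣ) : 𝔸)‖ ≤ 1) :
    ‖Scorr L 𝒯 V c‖ ≤ 24 * ε := by
  have hκ := sum_offAxis_weight_le_one hL c
  have hY : ‖Yexp L 𝒯 V c‖ ≤ 2 * ε := norm_Yexp_le hL V c hε0 (by linarith) hW
  have hA : ‖AdU (expU (Yexp L 𝒯 V c)) - 1‖ ≤ 8 * ε :=
    (norm_AdU_expU_sub_one_le _).trans (exp_two_mul_sub_one_le (norm_nonneg _) hY hε)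
  have hΦ : ‖PhiY (Yexp L 𝒯 V c) - 1‖ ≤ 8 * ε :=
    (norm_PhiY_sub_one_le _).trans (exp_two_mul_sub_one_le (norm_nonneg _) hY hε)
  have hΨ1 : ∀ x ∈ offAxis L c, ‖PsiW ((loopW L 𝒯 V c x : 𝔸ˣ) : 𝔸) - 1‖ ≤ 4 * ε :=
    fun x hx => norm_PsiW_sub_one_le (hW x hx) (by linarith)
  have hΨs : ‖∑ x ∈ offAxis L c, ((L : ℂ) ^ d)⁻¹ • PsiW ((loopW L 𝒯 V c x : 𝔸ˣ) : 𝔸)‖ ≤ 1 + 4 * ε := by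
    calc ‖∑ x ∈ offAxis L c, ((L : ℂ) ^ d)⁻¹ • PsiW ((loopW L 𝒯 V c x : 𝔸ˣ) : 𝔸)‖
          ≤ ∑ x ∈ offAxis L c, ‖((L : ℂ) ^ d)⁻¹ • PsiW ((loopW L 𝒯 V c x : 𝔸ˣ) : 𝔸)‖ := norm_sum_le _ _
      _ ≤ ∑ _x ∈ offAxis L c, ((L : ℝ) ^ d)⁻¹ * (1 + 4 * ε) := by
          refine sum_le_sum fun x hx =>
            (norm_weight_smul (E := 𝔸 →L[ℂ] 𝔸) (PsiW ((loopW L 𝒯 V c x : 𝔸ˣ) : 𝔸))).trans_le ?_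
          exact mul_le_mul_of_nonneg_left ((norm_PsiW_le _).trans (by linarith [hΨ1 x hx])) (by positivity)
      _ = (∑ _x ∈ offAxis L c, ((L : ℝ) ^ d)⁻¹) * (1 + 4 * ε) := by rw [sum_mul]
      _ ≤ 1 * (1 + 4 * ε) := mul_le_mul_of_nonneg_right hκ (by positivity)
      _ = 1 + 4 * ε := one_mul _
  have hΨd : ‖∑ x ∈ offAxis L c, ((L : ℂ) ^ d)⁻¹ • (PsiW ((loopW L 𝒯 V c x : 𝔸ˣ) : 𝔸) - 1)‖ ≤ 4 * ε := by
    calc ‖∑ x ∈ offAxis L c, ((L : ℂ) ^ d)⁻¹ • (PsiW ((loopW L 𝒯 V c x : 𝔸ˣ) : 𝔸) - 1)‖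
          ≤ ∑ x ∈ offAxis L c, ‖((L : ℂ) ^ d)⁻¹ • (PsiW ((loopW L 𝒯 V c x : 𝔸ˣ) : 𝔸) - 1)‖ := norm_sum_le _ _
      _ ≤ ∑ _x ∈ offAxis L c, ((L : ℝ) ^ d)⁻¹ * (4 * ε) := by
          refine sum_le_sum fun x hx =>
            (norm_weight_smul (E := 𝔸 →L[ℂ] 𝔸) (PsiW ((loopW L 𝒯 V c x : 𝔸ˣ) : 𝔸) - 1)).trans_le ?_
          exact mul_le_mul_of_nonneg_left (hΨ1 x hx) (by positivity)
      _ = (∑ _x ∈ offAxis L c, ((L : ℝ) ^ d)⁻¹) * (4 * ε) := by rw [sum_mul]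
      _ ≤ 1 * (4 * ε) := mul_le_mul_of_nonneg_right hκ (by positivity)
      _ = 4 * ε := one_mul _
  have hAd : ‖AdU (gcorner L V c)‖ ≤ 1 := norm_AdU_le_one hP hP'
  calc ‖Scorr L 𝒯 V c‖ ≤ (8 * ε + 8 * ε * (1 + 4 * ε) + 4 * ε) * 1 :=
        (norm_Scorr_le_struct hL 𝒯 V c).trans
          (mul_le_mul (add_le_add (add_le_add hA (mul_le_mul hΦ hΨs (norm_nonneg _) (by positivity))) hΨd) hAd
            (norm_nonneg _) (by positivity))
    _ ≤ 24 * ε := by nlinarith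

end Norms

/-! ## § 8  The `h`-paragraph of p. 267 for the GENUINE linearization `LQ̃_V`: the hypotheses of
`B12HOperatorNeumann267.h_paragraph_p267_mainTerm` DISCHARGED from the loop small field -/

section Paragraph

variable {𝔸 : Type*} [NormedRing 𝔸] [NormedAlgebra ℂ 𝔸] [NormOneClass 𝔸] [CompleteSpace 𝔸]
variable {L : ℕ} {𝒯 : (ZdEdge d → 𝔸ˣ) → (Fin d → ℤ) → 𝔸ˣ}

/-- [cite: Balaban1987RG1, p.267] **THE NEUMANN BUDGET `(Lᵈ/L)·‖S(c)‖ < 1` HOLDS** (the hypothesis `hS` of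
`B12HOperatorNeumann267.h_paragraph_p267_mainTerm`, i.e. the typed form of cell GAPS C-adv7-109 (b)) whenever
`(Lᵈ/L)·24ε < 1`, the off-axis block loops satisfy `‖W_x(V) − 1‖ ≤ ε ≤ 1/8` and `‖V(b)‖, ‖V(b)⁻¹‖ ≤ 1`. -/
theorem neumann_budget (hL : 0 < L) (V : ZdEdge d → 𝔸ˣ) {ε : ℝ} (hε0 : 0 ≤ ε) (hε : ε ≤ 1 / 8)
    (hW : ∀ c, ∀ x ∈ offAxis L c, ‖((loopW L 𝒯 V c x : 𝔸ˣ) : 𝔸) - 1‖ ≤ ε)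
    (hV : ∀ b, ‖((V b : 𝔸ˣ) : 𝔸)‖ ≤ 1) (hV' : ∀ b, ‖(((V b)⁻¹ : 𝔸ˣ) : 𝔸)‖ ≤ 1)
    (hbud : (L : ℝ) ^ d / L * (24 * ε) < 1) (c : ZdEdge d) :
    (L : ℝ) ^ d / L * ‖Scorr L 𝒯 V c‖ < 1 :=
  lt_of_le_of_lt (mul_le_mul_of_nonneg_left
    (norm_Scorr_le hL 𝒯 V c hε0 hε (hW c) (norm_gcorner_le hV hV' c).1 (norm_gcorner_le hV hV' c).2)
    (by positivity)) hbud

/-- [folklore] the relative perturbation is a contraction: `‖KMain(c)⁻¹ S(c)‖ < 1`. -/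
theorem relPert_lt_one (hL : 0 < L) (h𝒯' : IsAxisStraightFamily L 𝒯) (V : ZdEdge d → 𝔸ˣ) {ε : ℝ}
    (hε0 : 0 ≤ ε) (hε : ε ≤ 1 / 8) (hW : ∀ c, ∀ x ∈ offAxis L c, ‖((loopW L 𝒯 V c x : 𝔸ˣ) : 𝔸) - 1‖ ≤ ε)
    (hV : ∀ b, ‖((V b : 𝔸ˣ) : 𝔸)‖ ≤ 1) (hV' : ∀ b, ‖(((V b)⁻¹ : 𝔸ˣ) : 𝔸)‖ ≤ 1)
    (hbud : (L : ℝ) ^ d / L * (24 * ε) < 1) (c : ZdEdge d) :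
    ‖relPert (KMain (axisStraight_conj h𝒯' V) hL (norm_Rconj_le hV) (norm_Rconj_inv_le hV') c)
      (Scorr L 𝒯 V c)‖ < 1 :=
  hH_of_budget (norm_KMain_symm_le _ hL _ _ c) (neumann_budget hL V hε0 hε hW hV hV' hbud c)

/-- [cite: Balaban1987RG1, p.267] **THE OPERATOR `h` OF P. 267 FOR THE GENUINE LINEARIZATION** of the average
(0.12) (corner cubes, transporter family `𝒯`): its fibre maps `h(c) = (K(c) − S(c))⁻¹` (Neumann series of
`B12HOperatorNeumann267.hNeu` around the main term `K(c) = L^{1−d}Ad_{g(c)}`). -/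
def hGen (hL : 0 < L) (h𝒯' : IsAxisStraightFamily L 𝒯) (V : ZdEdge d → 𝔸ˣ) {ε : ℝ} (hε0 : 0 ≤ ε)
    (hε : ε ≤ 1 / 8) (hW : ∀ c, ∀ x ∈ offAxis L c, ‖((loopW L 𝒯 V c x : 𝔸ˣ) : 𝔸) - 1‖ ≤ ε)
    (hV : ∀ b, ‖((V b : 𝔸ˣ) : 𝔸)‖ ≤ 1) (hV' : ∀ b, ‖(((V b)⁻¹ : 𝔸ˣ) : 𝔸)‖ ≤ 1)
    (hbud : (L : ℝ) ^ d / L * (24 * ε) < 1) (c : ZdEdge d) : 𝔸 →L[ℝ] 𝔸 :=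
  hNeu (KMain (axisStraight_conj h𝒯' V) hL (norm_Rconj_le hV) (norm_Rconj_inv_le hV')) (Scorr L 𝒯 V)
    (relPert_lt_one hL h𝒯' V hε0 hε hW hV hV' hbud) c

/-- [cite: Balaban1987RG1, p.267] **THE `h`-PARAGRAPH OF P. 267, GENUINE LINEARIZATION, SMALL FIELD** — the two
printed clauses (i), (ii) and the cell's bound (iii) (p. 267 prints no norm bound on `h`) for `𝒬 = LQ̃_V` (the directional derivative at `B′ = 0` of (2.4) for the average (0.12) with a
block-local, axis-straight transporter family): under `‖W_x(V) − 1‖ ≤ ε ≤ 1/8` on the off-axis block loops,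
`‖V(b)‖, ‖V(b)⁻¹‖ ≤ 1` and `(Lᵈ/L)·24ε < 1`,
(i) «LQ̃h = I»: `LQ̃_V (h B) = B` for the corridor-supported operator `h = hOp b₀ hGen`;
(ii) «h is uniquely defined»: every corridor-supported right inverse of `LQ̃_V` is this `h`;
(iii) `‖h(c)X‖ ≤ (Lᵈ/L)/(1 − (Lᵈ/L)·24ε)·‖X‖`.
All hypotheses of `B12HOperatorNeumann267.h_paragraph_p267_mainTerm` are discharged: `h𝒬` by `isQppLocal_LQ`,
`hK` by `bcoef_LQ_eq_coef_sub`, `hS` by `neumann_budget`. -/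
theorem h_paragraph_p267_genuine (hL : 0 < L) (h𝒯 : IsBlockLocal L 𝒯) (h𝒯' : IsAxisStraightFamily L 𝒯)
    (V : ZdEdge d → 𝔸ˣ) {ε : ℝ} (hε0 : 0 ≤ ε) (hε : ε ≤ 1 / 8)
    (hW : ∀ c, ∀ x ∈ offAxis L c, ‖((loopW L 𝒯 V c x : 𝔸ˣ) : 𝔸) - 1‖ ≤ ε)
    (hV : ∀ b, ‖((V b : 𝔸ˣ) : 𝔸)‖ ≤ 1) (hV' : ∀ b, ‖(((V b)⁻¹ : 𝔸ˣ) : 𝔸)‖ ≤ 1)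
    (hbud : (L : ℝ) ^ d / L * (24 * ε) < 1) :
    (∀ B c, LQ L 𝒯 V (hOp (b0Z L) (fun c X => hGen hL h𝒯' V hε0 hε hW hV hV' hbud c X) B) c = B c) ∧
    (∀ 𝒽 : (ZdEdge d → 𝔸) → ZdEdge d → 𝔸, CorridorSupported L 𝒽 → (∀ B c, LQ L 𝒯 V (𝒽 B) c = B c) →
        𝒽 = hOp (b0Z L) (fun c X => hGen hL h𝒯' V hε0 hε hW hV hV' hbud c X)) ∧
    (∀ c X, ‖hGen hL h𝒯' V hε0 hε hW hV hV' hbud c X‖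
        ≤ ((L : ℝ) ^ d / L) / (1 - (L : ℝ) ^ d / L * (24 * ε)) * ‖X‖) := by
  have hK : ∀ c X, bcoef L (LQ L 𝒯 V) c X = coef L (Tconj 𝒯 V) (Rconj V) c X - Scorr L 𝒯 V c X :=
    fun c X => bcoef_LQ_eq_coef_sub hL h𝒯 h𝒯' V c X fun x hx => (hW c x hx).trans_lt (by linarith)
  obtain ⟨h1, h2, h3⟩ := h_paragraph_p267_mainTerm (axisStraight_conj h𝒯' V) hL (norm_Rconj_le hV)
    (norm_Rconj_inv_le hV') (isQppLocal_LQ hL h𝒯 V) hK (neumann_budget hL V hε0 hε hW hV hV' hbud)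
  refine ⟨h1, h2, fun c X => (h3 c X).trans (mul_le_mul_of_nonneg_right ?_ (norm_nonneg X))⟩
  have ha : 0 ≤ (L : ℝ) ^ d / L := by positivity
  refine div_le_div_of_nonneg_left ha (by linarith) ?_
  have := mul_le_mul_of_nonneg_left
    (norm_Scorr_le hL 𝒯 V c hε0 hε (hW c) (norm_gcorner_le hV hV' c).1 (norm_gcorner_le hV hV' c).2) ha
  linarith

end Paragraph

/-! ## § 9  The printed instance: the contours `Γ_{y,x}` of [2] (1.7) satisfy both family hypotheses, so § 8
applies with no hypothesis on the average to [B7] (15) («Ū_c = exp[i Σ_{x∈B(c₋)} L⁻ᵈ (1/i) log U(Γ_{c,x}) U(c)⁻¹] U(c)»,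
[B12] p. 252 «the definition introduced in [12]») -/

section Instance

variable {G : Type*} [Group G] {L : ℕ}

omit [Group G] in
/-- [folklore] coordinates of a block site: `L yᵢ ≤ xᵢ < L yᵢ + L`. -/
theorem bounds_of_mem_blockSites {y x : Fin d → ℤ} (hx : x ∈ blockSites L y) (i : Fin d) :
    blockBase L y i ≤ x i ∧ x i < blockBase L y i + L := by
  simp only [blockSites, mem_image, Fintype.mem_piFinset, mem_range] at hx
  obtain ⟨t, ht, rfl⟩ := hx
  have := ht i
  simp only [Pi.add_apply]
  omega

omit [Group G] in
/-- [folklore] … and conversely. -/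
theorem mem_blockSites_of_bounds (hL : 0 < L) {y z : Fin d → ℤ}
    (h : ∀ i, blockBase L y i ≤ z i ∧ z i < blockBase L y i + L) : z ∈ blockSites L y := by
  haveI : NeZero L := ⟨hL.ne'⟩
  rw [mem_blockSites_iff]
  have hz : z = blockBase L y + (z - blockBase L y) := by abel
  rw [hz]
  exact blockMap_blockBase_add_of_lt L y _ (fun i => by simp only [Pi.sub_apply]; linarith [(h i).1])
    (fun i => by simp only [Pi.sub_apply]; linarith [(h i).2])

/-- [cite: Balaban1984PropagatorsI, (1.7) p.18] **the contours `Γ_{y,x}` lie in the block `B(y)`**: the parallel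
transporter `R(V₀(Γ_{y,x}))` is a BLOCK-LOCAL family (`IsBlockLocal`). -/
theorem isBlockLocal_gammaT (hL : 0 < L) : IsBlockLocal L (fun U : ZdEdge d → G => gammaT L U) := by
  intro U U' y x hx hUU'
  haveI : NeZero L := ⟨hL.ne'⟩
  have hy : blockMap L x = y := (mem_blockSites_iff L y x).1 hx
  have hbx := bounds_of_mem_blockSites hx
  have hL' : (0 : ℤ) < L := by exact_mod_cast hL
  simp only [gammaT, hy]
  refine congrArg List.prod (List.map_congr_left fun i _ => lineR_congr fun t ht => hUU' _ ?_ ?_)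
  · refine mem_blockSites_of_bounds hL fun j => ?_
    by_cases hj : j = i
    · subst hj
      have := hbx j
      simp only [Pi.add_apply, gammaPt, lt_self_iff_false, if_false, Pi.single_eq_same]
      omega
    · have := hbx j
      simp only [Pi.add_apply, gammaPt, Pi.single_eq_of_ne hj, add_zero]
      split_ifs
      · exact this
      · exact ⟨le_rfl, by linarith⟩
  · refine mem_blockSites_of_bounds hL fun j => ?_
    by_cases hj : j = i
    · subst hj
      have := hbx j
      simp only [Pi.add_apply, gammaPt, lt_self_iff_false, if_false, Pi.single_eq_same]
      omega
    · have := hbx j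
      simp only [Pi.add_apply, gammaPt, Pi.single_eq_of_ne hj, add_zero]
      split_ifs
      · exact this
      · exact ⟨le_rfl, by linarith⟩

/-- [folklore] the contours (1.7) are axis-straight for every configuration (`B12HOperator267.axisStraight_gammaT`). -/
theorem isAxisStraightFamily_gammaT (hL : 0 < L) : IsAxisStraightFamily L (fun U : ZdEdge d → G => gammaT L U) :=
  fun U => axisStraight_gammaT hL U

omit [Group G] in
/-- [folklore] an ordered product of `1`s. -/
theorem pathProd_constOne {M : Type*} [Monoid M] (n : ℕ) : pathProd (fun _ : ℕ => (1 : M)) n = 1 := by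
  induction n with
  | zero => rw [pathProd_zero]
  | succ n ih => rw [pathProd_succ, ih, one_mul]

/-- [folklore] at the flat configuration `U ≡ 1` every straight transporter is `1` … -/
theorem lineR_constOne (x : Fin d → ℤ) (μ : Fin d) (n : ℕ) : lineR (1 : ZdEdge d → G) x μ n = 1 := by
  unfold lineR
  exact pathProd_constOne n

/-- [folklore] … so is every contour transporter `R(1(Γ_{y,x})) = 1` … -/
theorem gammaT_constOne (L : ℕ) (x : Fin d → ℤ) : gammaT L (1 : ZdEdge d → G) x = 1 := by
  unfold gammaT
  exact List.prod_eq_one fun g hg => by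
    obtain ⟨i, -, rfl⟩ := List.mem_map.1 hg
    exact lineR_constOne _ _ _

/-- [folklore] … and every block loop: `W_x(1) = 1`. -/
theorem loopW_gammaT_constOne (L : ℕ) (c : ZdEdge d) (x : Fin d → ℤ) :
    loopW L (fun U : ZdEdge d → G => gammaT L U) 1 c x = 1 := by
  rw [loopW_def]
  simp only [gammaT_constOne, lineR_constOne, Ustr, inv_one, mul_one]

variable {𝔸 : Type*} [NormedRing 𝔸] [NormedAlgebra ℂ 𝔸] [NormOneClass 𝔸] [CompleteSpace 𝔸]

/-- [cite: Balaban1985Averaging, (15) p.19][cite: Balaban1987RG1, p.267] **THE `h`-PARAGRAPH FOR THE AVERAGE (15) OF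
[B7]** («Ū_c = exp[i Σ_{x∈B(c₋)} L⁻ᵈ (1/i) log U(Γ_{c,x}) U(c)⁻¹] U(c)», `Γ_{c,x} = Γ_{c₋,x} ∪ [x, x(c)] ∪ Γ_{x(c),c₊}`
with the contours `Γ_{y,x}` of [2] (1.7) — [B12] p. 252 «the definition introduced in [12]», p. 254 «both definitions
are equally good for our purposes»): § 8 with BOTH family hypotheses PROVED (`isBlockLocal_gammaT`,
`isAxisStraightFamily_gammaT`), i.e. with no hypothesis on the average left. -/
theorem h_paragraph_p267_gammaT (hL : 0 < L) (V : ZdEdge d → 𝔸ˣ) {ε : ℝ} (hε0 : 0 ≤ ε) (hε : ε ≤ 1 / 8)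
    (hW : ∀ c, ∀ x ∈ offAxis L c, ‖((loopW L (fun U : ZdEdge d → 𝔸ˣ => gammaT L U) V c x : 𝔸ˣ) : 𝔸) - 1‖ ≤ ε)
    (hV : ∀ b, ‖((V b : 𝔸ˣ) : 𝔸)‖ ≤ 1) (hV' : ∀ b, ‖(((V b)⁻¹ : 𝔸ˣ) : 𝔸)‖ ≤ 1)
    (hbud : (L : ℝ) ^ d / L * (24 * ε) < 1) :
    (∀ B c, LQ L (fun U : ZdEdge d → 𝔸ˣ => gammaT L U) V
        (hOp (b0Z L) (fun c X => hGen hL (isAxisStraightFamily_gammaT hL) V hε0 hε hW hV hV' hbud c X) B) c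
          = B c) ∧
    (∀ 𝒽 : (ZdEdge d → 𝔸) → ZdEdge d → 𝔸, CorridorSupported L 𝒽 →
        (∀ B c, LQ L (fun U : ZdEdge d → 𝔸ˣ => gammaT L U) V (𝒽 B) c = B c) →
        𝒽 = hOp (b0Z L) (fun c X => hGen hL (isAxisStraightFamily_gammaT hL) V hε0 hε hW hV hV' hbud c X)) ∧
    (∀ c X, ‖hGen hL (isAxisStraightFamily_gammaT hL) V hε0 hε hW hV hV' hbud c X‖
        ≤ ((L : ℝ) ^ d / L) / (1 - (L : ℝ) ^ d / L * (24 * ε)) * ‖X‖) :=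
  h_paragraph_p267_genuine hL (isBlockLocal_gammaT hL) (isAxisStraightFamily_gammaT hL) V hε0 hε hW hV hV' hbud

omit [NormedAlgebra ℂ 𝔸] [CompleteSpace 𝔸] in
/-- [folklore] **NON-VACUITY**: at the flat configuration `V ≡ 1` (every `d`, every `L ≥ 1`) all four hypotheses of
`h_paragraph_p267_gammaT` hold with `ε = 0` (so the hypothesis set is consistent; there `S(c) = 0` and `h` is the
closed-form `hMain` of `B12HOperator267`). -/
theorem flat_hypotheses (L : ℕ) :
    (∀ c, ∀ x ∈ offAxis L c,
        ‖((loopW L (fun U : ZdEdge d → 𝔸ˣ => gammaT L U) (1 : ZdEdge d → 𝔸ˣ) c x : 𝔸ˣ) : 𝔸) - 1‖ ≤ (0 : ℝ)) ∧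
    (∀ b, ‖(((1 : ZdEdge d → 𝔸ˣ) b : 𝔸ˣ) : 𝔸)‖ ≤ 1) ∧
    (∀ b, ‖((((1 : ZdEdge d → 𝔸ˣ) b)⁻¹ : 𝔸ˣ) : 𝔸)‖ ≤ 1) ∧
    (L : ℝ) ^ d / L * (24 * (0 : ℝ)) < 1 := by
  refine ⟨fun c x _ => ?_, fun b => ?_, fun b => ?_, by norm_num⟩
  · rw [loopW_gammaT_constOne, Units.val_one, sub_self, norm_zero]
  · rw [Pi.one_apply, Units.val_one, norm_one]
  · rw [Pi.one_apply, inv_one, Units.val_one, norm_one]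

end Instance

end Literature.MathematicalPhysics.QuantumFieldTheory.Balaban1983to89.B12AverageCorridor267

end
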